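import Literature.NumberTheory.LFunctions.AlternativeHypothesisLemma6Proofs
import Literature.NumberTheory.LFunctions.AlternativeHypothesisFormFactorUniformProofs
import HarnessLib

/-!
# BGSTB 2025, Corollary 5 and Lemma 6 — UNIFORMLY in the AH-Pairs level (row «U», part 2):
# CORE forms (inputs abstracted) and the M-free LIMIT forms consumed by the Theorem-3 assembly

Topic `Literature/NumberTheory/LFunctions` (namespace `Literature.NumberTheory.LFunctions`; all
declarations in the sub-namespace `AH`). PROOF LAYER, theorems only (no definitions, no named facts),
cell `rh-crit/ah` (C5, seat t5, row «U»). LABEL: **NOT RH-BEARING** — every statement here is a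
CONDITIONAL `RiemannHypothesis → AHPairs → …` (or has the RH/AH inputs as explicit hypotheses); RH and
AH-Pairs stay hypotheses and nothing here bears on the truth of either.

S. A. C. Baluyot, D. A. Goldston, A. I. Suriajaya, C. L. Turnage-Butterbaugh, *The Alternative
Hypothesis for zeros of the Riemann zeta-function*, arXiv:2508.10857 (2025), UNREFEREED: §5
Corollary 5, §6 Lemma 6 (i)–(iv), and the bookkeeping of §7 (proof of Theorem 3, p. 16: "we let
`T → ∞` and then `M → ∞`", after which the test function forces `λ → 0`).

## Why this file exists

The landed proofs of Corollary 5 (`bgstb2025_corollary5_of_lemma5_rh`, seat t6) and of Lemma 6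
(i)/(ii)/(iii-odd, two-sided)/(±1) (`AlternativeHypothesisLemma6Proofs`, seat t5) consume the AH half
of Lemma 5 in the shape `C₂ · E_G(λ, ·)` at the AH-Pairs level `M`, where the tree's `C₂` grows with
`M` (see `AlternativeHypothesisFormFactorUniformProofs`). Part 1 of row «U» re-proved Lemma 5
(iii)–(iv) with SPLIT constants and repackaged the split bound as ONE `E_G` with ABSOLUTE leading
constant `1` at the rescaled level `M' = M/A` and a `T`-vanishing rate `R'`
(`bgstb2025_lemma5_ah_usplit_errG`). This file

* §C re-runs the landed proofs VERBATIM as **core theorems** with their inputs abstracted — Lemma 5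
  (i)–(ii) with constant `C₁`, the AH half as `C₂ · E_G` at an arbitrary level `M'`, rate `R'`, bins
  at `M_b` — and with the resulting constants EXPLICIT (`14|C₂| + 8|C₁| + 6`, `100(|C₁| + |C₂|)`,
  `(13/2)|C₂|`, `4|C| + |C₂|`, `|C| + |C₂|`, `8(|C₁| + |C₂|) + 1`, `|C|`, `|C| + |C₄|`): fed with
  `C₂ = 1` every downstream constant is ABSOLUTE;
* §L proves, under `RiemannHypothesis` and `AHPairs`, the **M-free limit forms** of the window
  estimates that the Theorem-3 assembly (`AlternativeHypothesisTheorem3Assembly`, seat t2) takes as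
  named hypotheses: (W-even) `AH.window_even_limit`, (W-ii) `AH.window_nonint_limit`, (W-odd)
  `AH.window_odd_limit`, (W-one) `AH.window_one_limit`, together with (W-P) `AH.exists_binDensity_zero_le`
  (`P₀(T) = O(1)` under RH, a theorem — not a hypothesis) and the level-wise uniform input
  `AH.exists_uniform_input`. Shape (W-even): `∀ L ε, 0 < ε → ∃ λ₀ > 0, ∀ λ ∈ (0, λ₀], ∀ᶠ T,
  |∫_{2L−λ}^{2L+λ} F(β, T) dβ − 1| ≤ ε`; (W-odd)/(W-one) carry the bin parameter `M_b ≥ δ/2` of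
  `P₀ = AH.binDensity 0 T M_b δ` freely (the bin does not depend on it, `AH.binDensity_eq_binDensity_of_le`).

OURS throughout (quantifier bookkeeping; the printed statements carry `O`-terms with absolute
constants and the level `𝓜` inside `E_G`, §5 (E_G) p. 12: "`E_G(λ, α) := 1/(λ²M) + (|α|+1)M²R(T) +
1/log T`, where `M`, `T`, and `R(T)` are from AH-Pairs"). Lemma 6 (iii) enters in OUR sound two-sided
form (lower half: Corollary 5 at `λ/2`; upper half: tent majorant at a fixed outer radius `μ₀(ε)`),
the printed proof of (iii)–(v) being unsupported as printed (cell erratum E-ah-5, see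
`AlternativeHypothesisLemma6Proofs` §4); nothing landed is edited.

## References

* [BaluyotGoldstonSuriajayaTurnageButterbaugh2025] arXiv:2508.10857, §5 (E_G), Lemma 5, Corollary 5
  (held text `paper:arxiv-2508.10857`, p0012–p0013); §6 Lemma 6 and its proof (p0014–p0015); §7
  proof of Theorem 3 (p0016).
* [Montgomery1973] H. L. Montgomery, Proc. Sympos. Pure Math. 24 (1973) (pair-window count, `P₀ = O(1)`).
* Cell records: `run/shared/lean/pub/rh-crit/ah/MEMO-t5-UniformAH.md` (row «U»); ah/STATUS.md
  2026-08-26T17:00:11Z (t2 g3, the (W-·) hypothesis shapes) and R-g6-19.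
-/

noncomputable section

open scoped Real Topology FourierTransform
open Filter Set MeasureTheory Asymptotics

namespace Literature.NumberTheory.LFunctions

/-! ## §C. CORE forms of the landed Corollary-5 / Lemma-6 proofs (inputs abstracted) -/


set_option maxHeartbeats 400000 in
/-- **Corollary 5, CORE form** (the tree's proof of `bgstb2025_corollary5_of_lemma5_rh`, seat t6,
re-run verbatim with the inputs abstracted): from Lemma 5 (i)–(ii) with constant `C₁` and the
AH-half (iii)–(iv) in the shape `C₂ · E_G` at an arbitrary level `M'` and rate `R'` (bins at `Mb`),
`|∫_{1−λ}^{1+λ} G_λ − 2(P₀ − 1)| ≤ (14|C₂| + 8|C₁| + 6)(λ + E_G(λ, 1) + 1/(λ²√log T))`, the constant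
being EXPLICIT in `C₁, C₂`. Printed: "`∫_{1−λ}^{1+λ} G_λ(α) dα = 2(P_0−1) + O(λ) + O(E_G(λ,1))
+ O(1/(λ²√log T))`" (Corollary 5, p. 12).
[cite: BaluyotGoldstonSuriajayaTurnageButterbaugh2025, Corollary 5 (proof §5)] -/
theorem AH.corollary5_core {C₁ C₂ Mb M' δ : ℝ} {R' : ℝ → ℝ} (hM' : 0 < M')
    (hR0 : ∀ T, 0 < R' T) (hδ1 : δ ≤ 1)
    (h₁ : ∀ᶠ T : ℝ in atTop, ∀ lam : ℝ, 0 < lam → lam ≤ 1 / 2 → ∀ α : ℝ,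
      (|α| < lam →
        |AH.heathBrownG lam α T - (lam - |α|) / lam ^ 2| ≤
          C₁ * (lam + 1 / (lam * Real.sqrt (Real.log T)) + 1 / (lam ^ 2 * Real.log T))) ∧
      (lam ≤ |α| → |α| ≤ 1 - lam →
        abs (AH.heathBrownG lam α T - |α|) ≤
          C₁ * (1 / Real.sqrt (Real.log T) + 1 / (lam ^ 2 * Real.log T))))
    (h₂ : ∀ᶠ T : ℝ in atTop, ∀ lam : ℝ, 0 < lam → lam ≤ 1 / 2 → ∀ α : ℝ,
      ‖(AH.heathBrownG lam α T : ℂ) -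
          ∑' k : ℤ, Complex.exp (π * k * α * Complex.I) *
            ((Real.sinc (lam * π * k / 2) ^ 2 * AH.binDensity k T Mb δ : ℝ) : ℂ)‖ ≤
        C₂ * AH.errG M' (R' T) T lam α ∧
      ∀ L : ℤ, |AH.heathBrownG lam (α + 2 * L) T - AH.heathBrownG lam α T| ≤
        C₂ * AH.errG M' (R' T) T lam (|α| + 2 * |(L : ℝ)|)) :
    ∀ᶠ T : ℝ in atTop, ∀ lam : ℝ, 0 < lam → lam ≤ 1 / 4 →
      |(∫ α in (1 - lam)..(1 + lam), AH.heathBrownG lam α T) - 2 * (AH.binDensity 0 T Mb δ - 1)| ≤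
        (14 * |C₂| + 8 * |C₁| + 6) *
          (lam + AH.errG M' (R' T) T lam 1 + 1 / (lam ^ 2 * Real.sqrt (Real.log T))) := by
  filter_upwards [h₁, h₂, eventually_ge_atTop (3 : ℝ)] with T hT₁ hT₂ hT3
  intro lam hlam hlam4
  have hT1 : (1 : ℝ) < T := by linarith
  have hlam2 : lam ≤ 1 / 2 := by linarith
  have hlam1 : lam ≤ 1 := by linarith
  -- `log T ≥ 1`
  have hlog1 : 1 ≤ Real.log T := by
    rw [← Real.log_exp 1]
    exact Real.log_le_log (Real.exp_pos 1) (by have := Real.exp_one_lt_d9; linarith)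
  have hlog0 : 0 < Real.log T := by linarith
  have hsq1 : 1 ≤ Real.sqrt (Real.log T) := by
    rw [show (1 : ℝ) = Real.sqrt 1 by simp]; exact Real.sqrt_le_sqrt hlog1
  have hsq0 : 0 < Real.sqrt (Real.log T) := by linarith
  have hsqle : Real.sqrt (Real.log T) ≤ Real.log T := by
    have h := Real.sq_sqrt hlog0.le
    nlinarith
  -- notation
  set G : ℝ → ℝ := fun α ↦ AH.heathBrownG lam α T with hG
  set E1 : ℝ := AH.errG M' (R' T) T lam 1 with hE1
  set Q : ℝ := 1 / (lam ^ 2 * Real.sqrt (Real.log T)) with hQ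
  set P0 : ℝ := AH.binDensity 0 T Mb δ with hP0
  have hE10 : 0 ≤ E1 := by
    rw [hE1]; unfold AH.errG
    have := hR0 T
    positivity
  have hQ0 : 0 ≤ Q := by positivity
  have hGc : Continuous G := AH.continuous_heathBrownG lam T
  have hGi : ∀ a b : ℝ, IntervalIntegrable G volume a b := fun a b ↦ hGc.intervalIntegrable a b
  have hab1 := (hT₁ lam hlam hlam2)
  have hab2 := (hT₂ lam hlam hlam2)
  -- `E_G(λ, α) ≤ (|α| + 1) E_G(λ, 1)`
  have hEle : ∀ α : ℝ, AH.errG M' (R' T) T lam α ≤ (|α| + 1) * E1 := fun α ↦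
    AH.errG_le_mul_errG_one hM'.le (hR0 T).le hT1
  -- useful comparisons
  have hQ1 : 1 / Real.sqrt (Real.log T) ≤ Q := by
    rw [hQ]
    apply div_le_div_of_nonneg_left zero_le_one (by positivity)
    calc lam ^ 2 * Real.sqrt (Real.log T) ≤ 1 * Real.sqrt (Real.log T) := by
          gcongr; nlinarith
      _ = Real.sqrt (Real.log T) := one_mul _
  have hQ2 : 1 / (lam ^ 2 * Real.log T) ≤ Q := by
    rw [hQ]
    apply div_le_div_of_nonneg_left zero_le_one (by positivity)
    exact mul_le_mul_of_nonneg_left hsqle (by positivity)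
  have hQ3 : 1 / (lam * Real.log T) ≤ Q := by
    rw [hQ]
    apply div_le_div_of_nonneg_left zero_le_one (by positivity)
    -- `λ² √L ≤ λ L` since `λ ≤ 1 ≤ √L`
    have h1 : lam ^ 2 * Real.sqrt (Real.log T) = lam * (lam * Real.sqrt (Real.log T)) := by ring
    rw [h1]
    refine mul_le_mul_of_nonneg_left ?_ hlam.le
    calc lam * Real.sqrt (Real.log T) ≤ 1 * Real.sqrt (Real.log T) := by gcongr
      _ ≤ Real.sqrt (Real.log T) * Real.sqrt (Real.log T) := by
          rw [one_mul]; exact le_mul_of_one_le_left hsq0.le hsq1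
      _ = Real.log T := Real.mul_self_sqrt hlog0.le
  ---------------------------------------------------------------------------
  -- (Cor5-1): `|∫_0^2 G − 2P₀| ≤ 6|C₂| E1`
  ---------------------------------------------------------------------------
  have hN : 2 * Mb + 1 ≤ ((⌈2 * Mb + 1⌉₊ : ℕ) : ℝ) := Nat.le_ceil _
  set N : ℕ := ⌈2 * Mb + 1⌉₊ with hNdef
  set b : ℤ → ℝ := fun k ↦ Real.sinc (lam * π * k / 2) ^ 2 * AH.binDensity k T Mb δ with hb
  set Sf : ℝ → ℂ := fun α ↦ ∑ k ∈ Finset.Icc (-(N : ℤ)) N,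
    Complex.exp (π * k * α * Complex.I) * ((b k : ℝ) : ℂ) with hSf
  have hSf_eq : ∀ α : ℝ, ∑' k : ℤ, Complex.exp (π * k * α * Complex.I) *
      ((Real.sinc (lam * π * k / 2) ^ 2 * AH.binDensity k T Mb δ : ℝ) : ℂ) = Sf α := fun α ↦
    AH.tsum_mul_binDensity_eq_sum hδ1 hN _ _
  have hterm_c : ∀ k : ℤ, Continuous fun α : ℝ ↦
      Complex.exp (π * k * α * Complex.I) * ((b k : ℝ) : ℂ) := by
    intro k
    refine Continuous.mul ?_ continuous_const
    refine Complex.continuous_exp.comp ?_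
    exact ((continuous_const.mul Complex.continuous_ofReal).mul continuous_const)
  have hSfc : Continuous Sf := by
    rw [hSf]
    exact continuous_finsetSum _ fun k _ ↦ hterm_c k
  have hSf_int : ∫ α in (0 : ℝ)..2, Sf α = 2 * (P0 : ℂ) := by
    have hint : ∀ k ∈ Finset.Icc (-(N : ℤ)) N, IntervalIntegrable
        (fun α : ℝ ↦ Complex.exp (π * k * α * Complex.I) * ((b k : ℝ) : ℂ)) volume 0 2 :=
      fun k _ ↦ (hterm_c k).intervalIntegrable _ _
    rw [hSf]
    show (∫ α in (0 : ℝ)..2, ∑ k ∈ Finset.Icc (-(N : ℤ)) N,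
      Complex.exp (π * k * α * Complex.I) * ((b k : ℝ) : ℂ)) = 2 * (P0 : ℂ)
    rw [intervalIntegral.integral_finsetSum hint]
    simp_rw [intervalIntegral.integral_mul_const, AH.integral_cexp_pi_mul_int, ite_mul, zero_mul]
    rw [Finset.sum_ite_eq']
    have h0 : (0 : ℤ) ∈ Finset.Icc (-(N : ℤ)) N := by simp
    rw [if_pos h0, hb]
    simp [hP0]
  have hGC : IntervalIntegrable (fun α ↦ (G α : ℂ)) volume 0 2 :=
    (Complex.continuous_ofReal.comp hGc).intervalIntegrable _ _
  have hdiff : ‖(∫ α in (0 : ℝ)..2, ((G α : ℂ) - Sf α))‖ ≤ 3 * |C₂| * E1 * |(2 : ℝ) - 0| := by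
    refine intervalIntegral.norm_integral_le_of_norm_le_const fun α hα ↦ ?_
    rw [Set.uIoc_of_le (by norm_num)] at hα
    have hαabs : |α| ≤ 2 := abs_le.mpr ⟨by linarith [hα.1], hα.2⟩
    have h := (hab2 α).1
    rw [hSf_eq α] at h
    calc ‖(G α : ℂ) - Sf α‖ ≤ C₂ * AH.errG M' (R' T) T lam α := h
      _ ≤ |C₂| * AH.errG M' (R' T) T lam α := by
          refine mul_le_mul_of_nonneg_right (le_abs_self _) ?_
          unfold AH.errG; have := hR0 T; positivity
      _ ≤ |C₂| * ((|α| + 1) * E1) := mul_le_mul_of_nonneg_left (hEle α) (abs_nonneg _)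
      _ ≤ |C₂| * (3 * E1) := by gcongr; linarith
      _ = 3 * |C₂| * E1 := by ring
  have hcor1 : |(∫ α in (0 : ℝ)..2, G α) - 2 * P0| ≤ 6 * |C₂| * E1 := by
    have e : (∫ α in (0 : ℝ)..2, ((G α : ℂ) - Sf α)) =
        (((∫ α in (0 : ℝ)..2, G α) - 2 * P0 : ℝ) : ℂ) := by
      rw [intervalIntegral.integral_sub hGC (hSfc.intervalIntegrable _ _), hSf_int,
        intervalIntegral.integral_ofReal]
      push_cast; ring
    rw [e, Complex.norm_real, Real.norm_eq_abs] at hdiff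
    norm_num at hdiff
    linarith
  ---------------------------------------------------------------------------
  -- (Cor5-2): periodicity and evenness
  ---------------------------------------------------------------------------
  -- `|G(β + 2) − G(β)| ≤ 4|C₂|E1` for `|β| ≤ 1`
  have hper : ∀ β : ℝ, |β| ≤ 1 → |G (β + 2) - G β| ≤ 4 * |C₂| * E1 := by
    intro β hβ
    have h := (hab2 β).2 1
    have e : β + 2 * ((1 : ℤ) : ℝ) = β + 2 := by norm_num
    rw [e] at h
    calc |G (β + 2) - G β| ≤ C₂ * AH.errG M' (R' T) T lam (|β| + 2 * |((1 : ℤ) : ℝ)|) := h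
      _ ≤ |C₂| * AH.errG M' (R' T) T lam (|β| + 2 * |((1 : ℤ) : ℝ)|) := by
          refine mul_le_mul_of_nonneg_right (le_abs_self _) ?_
          unfold AH.errG; have := hR0 T; positivity
      _ ≤ |C₂| * ((|(|β| + 2 * |((1 : ℤ) : ℝ)|)| + 1) * E1) :=
          mul_le_mul_of_nonneg_left (hEle _) (abs_nonneg _)
      _ ≤ |C₂| * (4 * E1) := by
          gcongr
          have : |(|β| + 2 * |((1 : ℤ) : ℝ)|)| = |β| + 2 := by
            rw [abs_of_nonneg (by positivity)]; norm_num
          rw [this]; linarith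
      _ = 4 * |C₂| * E1 := by ring
  -- `∫_{2−λ}^{2} G = ∫_{−λ}^{0} G + θ₂`
  have hθ2 : |(∫ α in (2 - lam)..2, G α) - ∫ β in (-lam)..0, G β| ≤ 4 * |C₂| * E1 := by
    have e : (∫ α in (2 - lam)..2, G α) = ∫ β in (-lam)..0, G (β + 2) := by
      rw [intervalIntegral.integral_comp_add_right G 2]
      congr 1 <;> ring
    have hGs : IntervalIntegrable (fun β : ℝ ↦ G (β + 2)) volume (-lam) 0 :=
      (hGc.comp (continuous_id.add continuous_const) : Continuous fun β : ℝ ↦ G (β + 2))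
        |>.intervalIntegrable _ _
    rw [e, ← intervalIntegral.integral_sub hGs (hGi _ _)]
    have h := intervalIntegral.norm_integral_le_of_norm_le_const (a := -lam) (b := 0)
      (C := 4 * |C₂| * E1) (f := fun β ↦ G (β + 2) - G β) fun β hβ ↦ by
        rw [Set.uIoc_of_le (by linarith)] at hβ
        rw [Real.norm_eq_abs]
        exact hper β (abs_le.mpr ⟨by linarith [hβ.1], by linarith [hβ.2]⟩)
    rw [Real.norm_eq_abs] at h
    refine h.trans ?_
    rw [show |(0 : ℝ) - -lam| = lam by rw [sub_neg_eq_add, zero_add, abs_of_pos hlam]]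
    have : 0 ≤ 4 * |C₂| * E1 := by positivity
    nlinarith
  -- `∫_{1+λ}^{2−λ} G = ∫_{λ}^{1−λ} G + θ₃`
  have hθ3 : |(∫ α in (1 + lam)..(2 - lam), G α) - ∫ α in lam..(1 - lam), G α| ≤ 4 * |C₂| * E1 := by
    have e1 : (∫ α in (1 + lam)..(2 - lam), G α) = ∫ β in (lam - 1)..(-lam), G (β + 2) := by
      rw [intervalIntegral.integral_comp_add_right G 2]
      congr 1 <;> ring
    have e2 : (∫ α in lam..(1 - lam), G α) = ∫ β in (lam - 1)..(-lam), G β := by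
      have h := intervalIntegral.integral_comp_neg (a := lam) (b := 1 - lam) G
      have hev : (fun x ↦ G (-x)) = G := by
        funext x; simp only [hG]; exact AH.heathBrownG_neg lam x T
      rw [hev] at h
      rw [h]
      congr 1; ring
    have hGs : IntervalIntegrable (fun β : ℝ ↦ G (β + 2)) volume (lam - 1) (-lam) :=
      (hGc.comp (continuous_id.add continuous_const) : Continuous fun β : ℝ ↦ G (β + 2))
        |>.intervalIntegrable _ _
    rw [e1, e2, ← intervalIntegral.integral_sub hGs (hGi _ _)]
    have h := intervalIntegral.norm_integral_le_of_norm_le_const (a := lam - 1) (b := -lam)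
      (C := 4 * |C₂| * E1) (f := fun β ↦ G (β + 2) - G β) fun β hβ ↦ by
        rw [Set.uIoc_of_le (by linarith)] at hβ
        rw [Real.norm_eq_abs]
        exact hper β (abs_le.mpr ⟨by linarith [hβ.1], by linarith [hβ.2]⟩)
    rw [Real.norm_eq_abs] at h
    refine h.trans ?_
    rw [show |-lam - (lam - 1)| = 1 - 2 * lam by
      rw [show -lam - (lam - 1) = 1 - 2 * lam by ring]; exact abs_of_pos (by linarith)]
    have : 0 ≤ 4 * |C₂| * E1 := by positivity
    nlinarith
  ---------------------------------------------------------------------------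
  -- (Cor5-3): `|∫_{−λ}^{λ} G − 1| ≤ 2(|C₁| + 1)(λ² + Q + Q)·…`
  ---------------------------------------------------------------------------
  have hθ4 : |(∫ α in (-lam)..lam, G α) - 1| ≤ 2 * (|C₁| + 1) * (lam + 2 * Q) := by
    set e₁ : ℝ := lam + 1 / (lam * Real.sqrt (Real.log T)) + 1 / (lam ^ 2 * Real.log T) with he₁
    have he₁0 : 0 ≤ e₁ := by positivity
    -- pointwise on `Ioc (−λ) λ`
    have hpt : ∀ α ∈ Set.uIoc (-lam) lam, ‖G α - (lam - |α|) / lam ^ 2‖ ≤ (|C₁| + 1) * e₁ := by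
      intro α hα
      rw [Set.uIoc_of_le (by linarith)] at hα
      rw [Real.norm_eq_abs]
      rcases lt_or_eq_of_le hα.2 with hlt | heq
      · have hαabs : |α| < lam := abs_lt.mpr ⟨hα.1, hlt⟩
        calc |G α - (lam - |α|) / lam ^ 2| ≤ C₁ * e₁ := (hab1 α).1 hαabs
          _ ≤ |C₁| * e₁ := mul_le_mul_of_nonneg_right (le_abs_self _) he₁0
          _ ≤ (|C₁| + 1) * e₁ := by nlinarith [abs_nonneg C₁]
      · rw [heq, abs_of_pos hlam, sub_self, zero_div, sub_zero]
        have h := (hab1 lam).2 (by rw [abs_of_pos hlam]) (by rw [abs_of_pos hlam]; linarith)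
        rw [abs_of_pos hlam] at h
        have h' : |G lam - lam| ≤ |C₁| * (1 / Real.sqrt (Real.log T) + 1 / (lam ^ 2 * Real.log T)) :=
          h.trans (mul_le_mul_of_nonneg_right (le_abs_self _) (by positivity))
        have hcmp : 1 / Real.sqrt (Real.log T) + 1 / (lam ^ 2 * Real.log T) ≤ e₁ := by
          rw [he₁]
          have : 1 / Real.sqrt (Real.log T) ≤ 1 / (lam * Real.sqrt (Real.log T)) := by
            apply div_le_div_of_nonneg_left zero_le_one (by positivity)
            calc lam * Real.sqrt (Real.log T) ≤ 1 * Real.sqrt (Real.log T) := by gcongr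
              _ = _ := one_mul _
          linarith
        have hle1 : lam ≤ e₁ := by
          rw [he₁]
          have : 0 ≤ 1 / (lam * Real.sqrt (Real.log T)) := by positivity
          have : 0 ≤ 1 / (lam ^ 2 * Real.log T) := by positivity
          linarith
        have hC₁e : |C₁| * (1 / Real.sqrt (Real.log T) + 1 / (lam ^ 2 * Real.log T)) ≤ |C₁| * e₁ :=
          mul_le_mul_of_nonneg_left hcmp (abs_nonneg _)
        have hb := abs_le.mp h'
        have hCe0 : 0 ≤ |C₁| * e₁ := mul_nonneg (abs_nonneg _) he₁0
        rw [abs_le]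
        constructor <;> linarith
    have hint := intervalIntegral.norm_integral_le_of_norm_le_const hpt
    have htri : IntervalIntegrable (fun α : ℝ ↦ (lam - |α|) / lam ^ 2) volume (-lam) lam :=
      ((continuous_const.sub continuous_abs).div_const _ :
        Continuous fun α : ℝ ↦ (lam - |α|) / lam ^ 2).intervalIntegrable _ _
    rw [intervalIntegral.integral_sub (hGi _ _) htri,
      AH.integral_triangle_div_sq hlam, Real.norm_eq_abs] at hint
    rw [show |lam - -lam| = 2 * lam by rw [sub_neg_eq_add, ← two_mul, abs_of_pos (by linarith)]] at hint
    refine hint.trans ?_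
    -- `(|C₁|+1) e₁ · 2λ = 2(|C₁|+1)(λ² + 1/√L + 1/(λ L)) ≤ 2(|C₁|+1)(λ + 2Q)`
    have h1 : e₁ * lam ≤ lam + 2 * Q := by
      rw [he₁, add_mul, add_mul]
      have t1 : lam * lam ≤ lam := by nlinarith
      have t2 : 1 / (lam * Real.sqrt (Real.log T)) * lam = 1 / Real.sqrt (Real.log T) := by
        field_simp
      have t3 : 1 / (lam ^ 2 * Real.log T) * lam = 1 / (lam * Real.log T) := by
        field_simp
      rw [t2, t3]
      linarith
    have hC0 : 0 ≤ |C₁| + 1 := by positivity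
    calc (|C₁| + 1) * e₁ * (2 * lam) = 2 * (|C₁| + 1) * (e₁ * lam) := by ring
      _ ≤ 2 * (|C₁| + 1) * (lam + 2 * Q) := by gcongr
  ---------------------------------------------------------------------------
  -- (Cor5-4): `|∫_{λ}^{1−λ} G − (1/2 − λ)| ≤ 2|C₁| Q`
  ---------------------------------------------------------------------------
  have hθ5 : |(∫ α in lam..(1 - lam), G α) - (1 / 2 - lam)| ≤ 2 * |C₁| * Q := by
    set e₂ : ℝ := 1 / Real.sqrt (Real.log T) + 1 / (lam ^ 2 * Real.log T) with he₂
    have he₂0 : 0 ≤ e₂ := by positivity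
    have hpt : ∀ α ∈ Set.uIoc lam (1 - lam), ‖G α - α‖ ≤ |C₁| * e₂ := by
      intro α hα
      rw [Set.uIoc_of_le (by linarith)] at hα
      have hα0 : 0 < α := by linarith [hα.1]
      have h := (hab1 α).2 (by rw [abs_of_pos hα0]; exact hα.1.le) (by rw [abs_of_pos hα0]; exact hα.2)
      rw [abs_of_pos hα0] at h
      rw [Real.norm_eq_abs]
      exact h.trans (mul_le_mul_of_nonneg_right (le_abs_self _) he₂0)
    have hint := intervalIntegral.norm_integral_le_of_norm_le_const hpt
    have hid' : IntervalIntegrable (fun x : ℝ ↦ x) volume lam (1 - lam) :=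
      (continuous_id : Continuous fun x : ℝ ↦ x).intervalIntegrable _ _
    rw [intervalIntegral.integral_sub (hGi _ _) hid', integral_id, Real.norm_eq_abs] at hint
    have e : ((1 - lam) ^ 2 - lam ^ 2) / 2 = 1 / 2 - lam := by ring
    rw [e, show |1 - lam - lam| = 1 - 2 * lam by
      rw [show 1 - lam - lam = 1 - 2 * lam by ring]; exact abs_of_pos (by linarith)] at hint
    refine hint.trans ?_
    have h1 : e₂ ≤ 2 * Q := by rw [he₂]; linarith
    have hC0 : 0 ≤ |C₁| := abs_nonneg _
    calc |C₁| * e₂ * (1 - 2 * lam) ≤ |C₁| * e₂ * 1 := by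
          apply mul_le_mul_of_nonneg_left (by linarith) (by positivity)
      _ ≤ |C₁| * (2 * Q) * 1 := by gcongr
      _ = 2 * |C₁| * Q := by ring
  ---------------------------------------------------------------------------
  -- assembly
  ---------------------------------------------------------------------------
  have hsplit : (∫ α in (0 : ℝ)..2, G α) =
      (∫ α in (0 : ℝ)..lam, G α) + (∫ α in lam..(1 - lam), G α) +
        (∫ α in (1 - lam)..(1 + lam), G α) + (∫ α in (1 + lam)..(2 - lam), G α) +
        (∫ α in (2 - lam)..2, G α) := by
    rw [intervalIntegral.integral_add_adjacent_intervals (hGi _ _) (hGi _ _),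
      intervalIntegral.integral_add_adjacent_intervals (hGi _ _) (hGi _ _),
      intervalIntegral.integral_add_adjacent_intervals (hGi _ _) (hGi _ _),
      intervalIntegral.integral_add_adjacent_intervals (hGi _ _) (hGi _ _)]
  have hsym : (∫ α in (-lam)..lam, G α) = (∫ α in (-lam)..0, G α) + ∫ α in (0 : ℝ)..lam, G α :=
    (intervalIntegral.integral_add_adjacent_intervals (hGi _ _) (hGi _ _)).symm
  -- the identity
  have hid : (∫ α in (1 - lam)..(1 + lam), G α) - 2 * (P0 - 1) =
      ((∫ α in (0 : ℝ)..2, G α) - 2 * P0) - ((∫ α in (-lam)..lam, G α) - 1) -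
        2 * ((∫ α in lam..(1 - lam), G α) - (1 / 2 - lam)) -
        ((∫ α in (2 - lam)..2, G α) - ∫ β in (-lam)..0, G β) -
        ((∫ α in (1 + lam)..(2 - lam), G α) - ∫ α in lam..(1 - lam), G α) + 2 * lam := by
    rw [hsplit, hsym]; ring
  rw [hid]
  have b1 := abs_le.mp hcor1
  have b2 := abs_le.mp hθ4
  have b3 := abs_le.mp hθ5
  have b4 := abs_le.mp hθ2
  have b5 := abs_le.mp hθ3
  have hfin : 6 * |C₂| * E1 + 2 * (|C₁| + 1) * (lam + 2 * Q) + 2 * (2 * |C₁| * Q) +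
      4 * |C₂| * E1 + 4 * |C₂| * E1 + 2 * lam ≤
      (14 * |C₂| + 8 * |C₁| + 6) * (lam + E1 + Q) := by
    have hA : 0 ≤ |C₁| := abs_nonneg _
    have hB : 0 ≤ |C₂| := abs_nonneg _
    have d : (14 * |C₂| + 8 * |C₁| + 6) * (lam + E1 + Q) -
        (6 * |C₂| * E1 + 2 * (|C₁| + 1) * (lam + 2 * Q) + 2 * (2 * |C₁| * Q) +
          4 * |C₂| * E1 + 4 * |C₂| * E1 + 2 * lam) =
        14 * (|C₂| * lam) + 14 * (|C₂| * Q) + 6 * (|C₁| * lam) + 8 * (|C₁| * E1) + 2 * lam +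
          6 * E1 + 2 * Q := by ring
    have p1 : 0 ≤ |C₂| * lam := mul_nonneg hB hlam.le
    have p2 : 0 ≤ |C₂| * Q := mul_nonneg hB hQ0
    have p3 : 0 ≤ |C₁| * lam := mul_nonneg hA hlam.le
    have p4 : 0 ≤ |C₁| * E1 := mul_nonneg hA hE10
    linarith only [d, p1, p2, p3, p4, hlam.le, hE10, hQ0]
  rw [abs_le]
  constructor <;>
    linarith only [b1.1, b1.2, b2.1, b2.2, b3.1, b3.2, b4.1, b4.2, b5.1, b5.2, hfin, hlam.le]


/-- **Lemma 6 (i), CORE form** (the tree's proof of `bgstb2025_lemma6_i_of_lemma5_rh`, seat t5,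
re-run verbatim with the inputs abstracted): from Lemma 5 (i) with constant `C₁` and Lemma 5 (iv)
in the shape `C₂ · E_G` at an arbitrary level `M'` and rate `R'`, for all large `T`,
`|∫_{2L−λ}^{2L+λ} F − 1| ≤ 100(|C₁| + |C₂|)(λ² + λ E_G(λ, L) + 1/(λ√log T))` (`0 < λ ≤ 1/4`, `L ∈ ℤ`).
Printed (i): "`∫_{2L−λ}^{2L+λ} F(β) dβ = 1 + O(λ²) + O(λ E_G(λ, L)) + O(1/(λ √log T))`".
[cite: BaluyotGoldstonSuriajayaTurnageButterbaugh2025, Lemma 6 (i) and §6] -/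
theorem AH.lemma6_i_core {C₁ C₂ M' : ℝ} {R' : ℝ → ℝ} (hM' : 0 < M') (hR0 : ∀ T, 0 < R' T)
    (h₁ : ∀ᶠ T : ℝ in atTop, ∀ lam : ℝ, 0 < lam → lam ≤ 1 / 2 → ∀ α : ℝ,
      (|α| < lam →
        |AH.heathBrownG lam α T - (lam - |α|) / lam ^ 2| ≤
          C₁ * (lam + 1 / (lam * Real.sqrt (Real.log T)) + 1 / (lam ^ 2 * Real.log T))) ∧
      (lam ≤ |α| → |α| ≤ 1 - lam →
        abs (AH.heathBrownG lam α T - |α|) ≤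
          C₁ * (1 / Real.sqrt (Real.log T) + 1 / (lam ^ 2 * Real.log T))))
    (h₂ : ∀ᶠ T : ℝ in atTop, ∀ lam : ℝ, 0 < lam → lam ≤ 1 / 2 → ∀ α : ℝ, ∀ L : ℤ,
      |AH.heathBrownG lam (α + 2 * L) T - AH.heathBrownG lam α T| ≤
        C₂ * AH.errG M' (R' T) T lam (|α| + 2 * |(L : ℝ)|)) :
    ∀ᶠ T : ℝ in atTop, ∀ lam : ℝ, 0 < lam → lam ≤ 1 / 4 → ∀ L : ℤ,
      |(∫ β in (2 * L - lam)..(2 * L + lam), montgomeryFormFactor β T) - 1| ≤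
        100 * (|C₁| + |C₂|) *
          (lam ^ 2 + lam * AH.errG M' (R' T) T lam L + 1 / (lam * Real.sqrt (Real.log T))) := by
  filter_upwards [h₁, h₂, eventually_gt_atTop (1 : ℝ),
    Real.tendsto_log_atTop.eventually (eventually_ge_atTop (1 : ℝ))] with T hT₁ hT₂ hT1 hlogT
    lam hlam hlam4 L
  have hlog0 : 0 < Real.log T := by linarith
  have hsq1 : 1 ≤ Real.sqrt (Real.log T) := by
    rw [show (1 : ℝ) = Real.sqrt 1 by simp]
    exact Real.sqrt_le_sqrt hlogT
  have hsq0 : 0 < Real.sqrt (Real.log T) := by linarith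
  have hsqle : Real.sqrt (Real.log T) ≤ Real.log T := by
    have h := Real.sq_sqrt hlog0.le
    nlinarith
  have hRT : 0 ≤ R' T := (hR0 T).le
  -- abbreviations
  set F : ℝ → ℝ := fun β ↦ montgomeryFormFactor β T with hF
  set H : ℝ → ℝ := fun μ ↦ μ ^ 2 * AH.heathBrownG μ (2 * L) T with hH
  set E : ℝ := AH.errG M' (R' T) T lam L with hE
  have hE0 : 0 ≤ E := by
    simp only [hE, AH.errG]
    positivity
  -- (a)+(b): `|H μ − μ| ≤ Δ(μ)` for `λ/2 ≤ μ ≤ 3λ/2`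
  have hΔ : ∀ μ : ℝ, lam / 2 ≤ μ → μ ≤ 3 * lam / 2 →
      |H μ - μ| ≤ |C₁| * (μ ^ 3 + μ / Real.sqrt (Real.log T) + 1 / Real.log T) +
        |C₂| * μ ^ 2 * (4 * E) := by
    intro μ hμ1 hμ2
    have hμ0 : 0 < μ := by linarith
    have hμ12 : μ ≤ 1 / 2 := by linarith
    -- (a) Lemma 5 (i) at `α = 0`
    have ha := ((hT₁ μ hμ0 hμ12 0).1 (by simpa using hμ0))
    rw [abs_zero, sub_zero] at ha
    -- (b) Lemma 5 (iv) at `α = 0`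
    have hb := hT₂ μ hμ0 hμ12 0 L
    rw [zero_add, abs_zero, zero_add] at hb
    -- `E_G(μ, 2|L|) ≤ 4 E`
    have hEμ : AH.errG M' (R' T) T μ (2 * |(L : ℝ)|) ≤ 4 * E := by
      simp only [hE, AH.errG]
      rw [abs_mul, abs_two, abs_abs]
      have h1 : 1 / (μ ^ 2 * M') ≤ 4 * (1 / (lam ^ 2 * M')) := by
        rw [div_le_iff₀ (by positivity), show 4 * (1 / (lam ^ 2 * M')) * (μ ^ 2 * M') =
          (2 * μ) ^ 2 / lam ^ 2 by field_simp; ring]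
        rw [le_div_iff₀ (by positivity), one_mul]
        exact pow_le_pow_left₀ hlam.le (by linarith) 2
      have h2 : (2 * |(L : ℝ)| + 1) * M' ^ 2 * R' T ≤ 4 * ((|(L : ℝ)| + 1) * M' ^ 2 * R' T) := by
        have : 0 ≤ M' ^ 2 * R' T := by positivity
        nlinarith [abs_nonneg (L : ℝ)]
      have h3 : 1 / Real.log T ≤ 4 * (1 / Real.log T) := by
        have : 0 ≤ 1 / Real.log T := by positivity
        linarith
      linarith
    -- combine
    have hC₁ : C₁ * (μ + 1 / (μ * Real.sqrt (Real.log T)) + 1 / (μ ^ 2 * Real.log T)) ≤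
        |C₁| * (μ + 1 / (μ * Real.sqrt (Real.log T)) + 1 / (μ ^ 2 * Real.log T)) :=
      mul_le_mul_of_nonneg_right (le_abs_self _) (by positivity)
    have hC₂ : C₂ * AH.errG M' (R' T) T μ (2 * |(L : ℝ)|) ≤ |C₂| * (4 * E) := by
      calc C₂ * AH.errG M' (R' T) T μ (2 * |(L : ℝ)|) ≤ |C₂| * AH.errG M' (R' T) T μ (2 * |(L : ℝ)|) :=
            mul_le_mul_of_nonneg_right (le_abs_self _) (by simp only [AH.errG]; positivity)
        _ ≤ |C₂| * (4 * E) := mul_le_mul_of_nonneg_left hEμ (abs_nonneg _)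
    have hGa : |AH.heathBrownG μ 0 T - 1 / μ| ≤
        |C₁| * (μ + 1 / (μ * Real.sqrt (Real.log T)) + 1 / (μ ^ 2 * Real.log T)) := by
      have : μ / μ ^ 2 = 1 / μ := by field_simp
      rw [this] at ha
      exact ha.trans hC₁
    have hGb : |AH.heathBrownG μ (2 * L) T - AH.heathBrownG μ 0 T| ≤ |C₂| * (4 * E) :=
      hb.trans hC₂
    -- `H μ − μ = μ² (G_μ(2L) − G_μ(0)) + μ² (G_μ(0) − 1/μ)`
    have hsplit : H μ - μ = μ ^ 2 * (AH.heathBrownG μ (2 * L) T - AH.heathBrownG μ 0 T) +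
        μ ^ 2 * (AH.heathBrownG μ 0 T - 1 / μ) := by
      simp only [hH]
      field_simp
      ring
    rw [hsplit]
    calc |μ ^ 2 * (AH.heathBrownG μ (2 * L) T - AH.heathBrownG μ 0 T) +
          μ ^ 2 * (AH.heathBrownG μ 0 T - 1 / μ)|
        ≤ μ ^ 2 * |AH.heathBrownG μ (2 * L) T - AH.heathBrownG μ 0 T| +
          μ ^ 2 * |AH.heathBrownG μ 0 T - 1 / μ| := by
          refine (abs_add_le _ _).trans ?_
          rw [abs_mul, abs_mul, abs_of_nonneg (sq_nonneg μ)]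
      _ ≤ μ ^ 2 * (|C₂| * (4 * E)) +
          μ ^ 2 * (|C₁| * (μ + 1 / (μ * Real.sqrt (Real.log T)) + 1 / (μ ^ 2 * Real.log T))) := by
          gcongr
      _ = |C₁| * (μ ^ 3 + μ / Real.sqrt (Real.log T) + 1 / Real.log T) +
          |C₂| * μ ^ 2 * (4 * E) := by
          field_simp
          ring
  -- (c) each `Δ(μ)`, divided by `h = λ/2`, is within the target shape
  have hΔ' : ∀ μ : ℝ, lam / 2 ≤ μ → μ ≤ 3 * lam / 2 →
      2 / lam * |H μ - μ| ≤ 30 * (|C₁| + |C₂|) *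
        (lam ^ 2 + lam * E + 1 / (lam * Real.sqrt (Real.log T))) := by
    intro μ hμ1 hμ2
    have hμ0 : 0 < μ := by linarith
    have h := hΔ μ hμ1 hμ2
    have hA : 0 ≤ |C₁| := abs_nonneg _
    have hB : 0 ≤ |C₂| := abs_nonneg _
    -- bound each term
    have t1 : 2 / lam * (|C₁| * μ ^ 3) ≤ |C₁| * (7 * lam ^ 2) := by
      have : μ ^ 3 ≤ (3 * lam / 2) ^ 3 := pow_le_pow_left₀ hμ0.le hμ2 3
      have e := mul_le_mul_of_nonneg_left this hA
      have e' := mul_nonneg hA (pow_nonneg hlam.le 3)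
      rw [div_mul_eq_mul_div, div_le_iff₀ hlam]
      linarith
    have t2 : 2 / lam * (|C₁| * (μ / Real.sqrt (Real.log T))) ≤
        |C₁| * (3 * (1 / (lam * Real.sqrt (Real.log T)))) := by
      -- `2μ/λ ≤ 3` and `1 ≤ 1/(4λ)`
      have h3 : 2 / lam * μ ≤ 3 := by
        rw [div_mul_eq_mul_div, div_le_iff₀ hlam]; linarith
      have h4 : (3 : ℝ) / Real.sqrt (Real.log T) ≤ 3 * (1 / (lam * Real.sqrt (Real.log T))) := by
        rw [div_le_iff₀ hsq0]
        have : 1 / (lam * Real.sqrt (Real.log T)) * Real.sqrt (Real.log T) = 1 / lam := by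
          field_simp
        rw [mul_assoc, this]
        have : (1 : ℝ) ≤ 1 / lam := by rw [le_div_iff₀ hlam]; linarith
        linarith
      calc 2 / lam * (|C₁| * (μ / Real.sqrt (Real.log T)))
          = |C₁| * ((2 / lam * μ) / Real.sqrt (Real.log T)) := by ring
        _ ≤ |C₁| * (3 / Real.sqrt (Real.log T)) := by gcongr
        _ ≤ |C₁| * (3 * (1 / (lam * Real.sqrt (Real.log T)))) := by gcongr
    have t3 : 2 / lam * (|C₁| * (1 / Real.log T)) ≤
        |C₁| * (2 * (1 / (lam * Real.sqrt (Real.log T)))) := by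
      have : 1 / Real.log T ≤ 1 / Real.sqrt (Real.log T) :=
        one_div_le_one_div_of_le hsq0 hsqle
      calc 2 / lam * (|C₁| * (1 / Real.log T)) ≤ 2 / lam * (|C₁| * (1 / Real.sqrt (Real.log T))) := by
            gcongr
        _ = |C₁| * (2 * (1 / (lam * Real.sqrt (Real.log T)))) := by
            field_simp
    have t4 : 2 / lam * (|C₂| * μ ^ 2 * (4 * E)) ≤ |C₂| * (18 * (lam * E)) := by
      have : μ ^ 2 ≤ (3 * lam / 2) ^ 2 := pow_le_pow_left₀ hμ0.le hμ2 2
      have h' : 2 / lam * μ ^ 2 ≤ 9 / 2 * lam := by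
        rw [div_mul_eq_mul_div, div_le_iff₀ hlam]; nlinarith
      calc 2 / lam * (|C₂| * μ ^ 2 * (4 * E)) = |C₂| * (4 * E) * (2 / lam * μ ^ 2) := by ring
        _ ≤ |C₂| * (4 * E) * (9 / 2 * lam) := by gcongr
        _ = |C₂| * (18 * (lam * E)) := by ring
    have hpos1 : 0 ≤ lam ^ 2 := sq_nonneg _
    have hpos2 : 0 ≤ lam * E := by positivity
    have hpos3 : 0 ≤ 1 / (lam * Real.sqrt (Real.log T)) := by positivity
    calc 2 / lam * |H μ - μ|
        ≤ 2 / lam * (|C₁| * (μ ^ 3 + μ / Real.sqrt (Real.log T) + 1 / Real.log T) +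
            |C₂| * μ ^ 2 * (4 * E)) := by gcongr
      _ = 2 / lam * (|C₁| * μ ^ 3) + 2 / lam * (|C₁| * (μ / Real.sqrt (Real.log T))) +
            2 / lam * (|C₁| * (1 / Real.log T)) + 2 / lam * (|C₂| * μ ^ 2 * (4 * E)) := by ring
      _ ≤ |C₁| * (7 * lam ^ 2) + |C₁| * (3 * (1 / (lam * Real.sqrt (Real.log T)))) +
            |C₁| * (2 * (1 / (lam * Real.sqrt (Real.log T)))) + |C₂| * (18 * (lam * E)) := by
          linarith
      _ ≤ 30 * (|C₁| + |C₂|) * (lam ^ 2 + lam * E + 1 / (lam * Real.sqrt (Real.log T))) := by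
          have e1 := mul_nonneg hA hpos1
          have e2 := mul_nonneg hA hpos2
          have e3 := mul_nonneg hA hpos3
          have e4 := mul_nonneg hB hpos1
          have e5 := mul_nonneg hB hpos2
          have e6 := mul_nonneg hB hpos3
          linarith
  -- (d) the differencing, at `h = λ/2`
  set I : ℝ := ∫ β in (-lam)..lam, montgomeryFormFactor (2 * L + β) T with hI
  have hup := AH.integral_window_add_le hT1 hlam (half_pos hlam) (2 * (L : ℝ))
  have hlow := AH.integral_window_sub_le hT1 (half_pos hlam) (by linarith : lam / 2 < lam)
    (2 * (L : ℝ))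
  have hHlam : H lam = ∫ β in (-lam)..lam, (lam - |β|) * montgomeryFormFactor (2 * L + β) T := by
    simp only [hH]
    exact AH.sq_mul_heathBrownG hlam.ne' _ _
  have hHup : H (lam + lam / 2) =
      ∫ β in (-(lam + lam / 2))..(lam + lam / 2),
        (lam + lam / 2 - |β|) * montgomeryFormFactor (2 * L + β) T := by
    simp only [hH]
    exact AH.sq_mul_heathBrownG (by linarith) _ _
  have hHlow : H (lam - lam / 2) =
      ∫ β in (-(lam - lam / 2))..(lam - lam / 2),
        (lam - lam / 2 - |β|) * montgomeryFormFactor (2 * L + β) T := by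
    simp only [hH]
    exact AH.sq_mul_heathBrownG (by linarith) _ _
  rw [← hHlam, ← hHup] at hup
  rw [← hHlam, ← hHlow] at hlow
  -- `hup : λ/2 · I + H λ ≤ H(3λ/2)`, `hlow : H λ − λ/2 · I ≤ H(λ/2)`
  have hΔ1 := hΔ' lam (by linarith) (by linarith)
  have hΔ2 := hΔ' (lam + lam / 2) (by linarith) (by linarith)
  have hΔ3 := hΔ' (lam - lam / 2) (by linarith) (by linarith)
  set A : ℝ := 30 * (|C₁| + |C₂|) * (lam ^ 2 + lam * E + 1 / (lam * Real.sqrt (Real.log T)))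
    with hA
  -- from `|H μ − μ| ≤ (λ/2) A`:
  have hb1 : |H lam - lam| ≤ lam / 2 * A := by
    have := hΔ1; rw [div_mul_eq_mul_div, div_le_iff₀ hlam] at this; linarith
  have hb2 : |H (lam + lam / 2) - (lam + lam / 2)| ≤ lam / 2 * A := by
    have := hΔ2; rw [div_mul_eq_mul_div, div_le_iff₀ hlam] at this; linarith
  have hb3 : |H (lam - lam / 2) - (lam - lam / 2)| ≤ lam / 2 * A := by
    have := hΔ3; rw [div_mul_eq_mul_div, div_le_iff₀ hlam] at this; linarith
  have hI1 : I - 1 ≤ 2 * A := by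
    -- `λ/2 · I ≤ H(3λ/2) − H λ ≤ λ/2 + λ A`
    have h1 := (abs_le.mp hb2).2
    have h2 := (abs_le.mp hb1).1
    have key : lam / 2 * I ≤ lam / 2 * (1 + 2 * A) := by linarith
    have := le_of_mul_le_mul_left key (half_pos hlam)
    linarith
  have hI2 : -(2 * A) ≤ I - 1 := by
    -- `λ/2 · I ≥ H λ − H(λ/2) ≥ λ/2 − λ A`
    have h1 := (abs_le.mp hb1).1
    have h2 := (abs_le.mp hb3).2
    have key : lam / 2 * (1 - 2 * A) ≤ lam / 2 * I := by linarith
    have := le_of_mul_le_mul_left key (half_pos hlam)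
    linarith
  -- (e) rewrite the window integral and conclude
  have hIeq : (∫ β in (2 * L - lam)..(2 * L + lam), montgomeryFormFactor β T) = I := by
    rw [hI, intervalIntegral.integral_comp_add_left (fun β ↦ montgomeryFormFactor β T) (2 * (L : ℝ)),
      sub_eq_add_neg]
  rw [hIeq]
  have hfin : |I - 1| ≤ 2 * A := abs_le.mpr ⟨hI2, hI1⟩
  refine hfin.trans ?_
  rw [hA]
  have : 0 ≤ lam ^ 2 + lam * E + 1 / (lam * Real.sqrt (Real.log T)) := by positivity
  have e := mul_nonneg (add_nonneg (abs_nonneg C₁) (abs_nonneg C₂)) this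
  linarith


/-- **Transport `1 ↦ K = 2L + 1` of the averaged `G_μ`, CORE form** (the tree's
`AH.exists_abs_integral_heathBrownG_odd_sub_le` re-run verbatim with Lemma 5 (iv) abstracted as
`C₂ · E_G` at level `M'`, rate `R'`): for all large `T`, `0 < μ ≤ 1/4`, `L ∈ ℤ`,
`|∫_{K−μ}^{K+μ} G_μ − ∫_{1−μ}^{1+μ} G_μ| ≤ (13/2)|C₂| μ E_G(μ, K)`.
[cite: BaluyotGoldstonSuriajayaTurnageButterbaugh2025, Lemma 5 (iv) and §6] -/
theorem AH.heathBrownG_odd_transport_core {C₂ M' : ℝ} {R' : ℝ → ℝ} (hM' : 0 < M')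
    (hR0 : ∀ T, 0 < R' T)
    (h₂ : ∀ᶠ T : ℝ in atTop, ∀ lam : ℝ, 0 < lam → lam ≤ 1 / 2 → ∀ α : ℝ, ∀ L : ℤ,
      |AH.heathBrownG lam (α + 2 * L) T - AH.heathBrownG lam α T| ≤
        C₂ * AH.errG M' (R' T) T lam (|α| + 2 * |(L : ℝ)|)) :
    ∀ᶠ T : ℝ in atTop, ∀ mu : ℝ, 0 < mu → mu ≤ 1 / 4 → ∀ L : ℤ,
      |(∫ α in ((2 * L + 1 : ℝ) - mu)..((2 * L + 1 : ℝ) + mu), AH.heathBrownG mu α T) -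
          ∫ α in (1 - mu)..(1 + mu), AH.heathBrownG mu α T| ≤
        13 / 2 * |C₂| * mu * AH.errG M' (R' T) T mu (2 * L + 1) := by
  filter_upwards [h₂, eventually_gt_atTop (1 : ℝ)] with T hT hT1 mu hmu hmu4 L
  have hlog : 0 < Real.log T := Real.log_pos hT1
  have hRT : 0 < R' T := hR0 T
  have hGc : Continuous fun α : ℝ ↦ heathBrownG mu α T := continuous_heathBrownG mu T
  have hGc' : Continuous fun α : ℝ ↦ heathBrownG mu (α + 2 * L) T :=
    hGc.comp (continuous_id.add continuous_const)
  -- shift the window at `K` back to the window at `1`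
  have hshift : ∫ α in ((2 * L + 1 : ℝ) - mu)..((2 * L + 1 : ℝ) + mu), heathBrownG mu α T =
      ∫ α in (1 - mu)..(1 + mu), heathBrownG mu (α + 2 * L) T := by
    rw [intervalIntegral.integral_comp_add_right (fun α ↦ heathBrownG mu α T) (2 * (L : ℝ)),
      show (1 : ℝ) - mu + 2 * L = 2 * L + 1 - mu by ring,
      show (1 : ℝ) + mu + 2 * L = 2 * L + 1 + mu by ring]
  rw [hshift, ← intervalIntegral.integral_sub (hGc'.intervalIntegrable _ _)
    (hGc.intervalIntegrable _ _)]
  -- pointwise bound on the window `|α| ≤ 5/4`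
  have hK : 2 * |(L : ℝ)| ≤ |(2 * L + 1 : ℝ)| + 1 := by
    have h := abs_sub (2 * (L : ℝ) + 1) 1
    rw [add_sub_cancel_right, abs_mul, abs_two, abs_one] at h
    exact h
  have hbound : ∀ α ∈ Set.uIoc (1 - mu) (1 + mu),
      ‖heathBrownG mu (α + 2 * L) T - heathBrownG mu α T‖ ≤
        13 / 4 * |C₂| * errG M' (R' T) T mu (2 * L + 1) := by
    intro α hα
    rw [Set.uIoc_of_le (by linarith)] at hα
    have hα' : |α| ≤ 5 / 4 := abs_le.mpr ⟨by linarith [hα.1], by linarith [hα.2]⟩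
    have h1 := hT mu hmu (by linarith) α L
    have hE0 : 0 ≤ errG M' (R' T) T mu (|α| + 2 * |(L : ℝ)|) := by
      simp only [errG]
      positivity
    have h2 : C₂ * errG M' (R' T) T mu (|α| + 2 * |(L : ℝ)|) ≤
        |C₂| * errG M' (R' T) T mu (|α| + 2 * |(L : ℝ)|) :=
      mul_le_mul_of_nonneg_right (le_abs_self _) hE0
    have h3 : errG M' (R' T) T mu (|α| + 2 * |(L : ℝ)|) ≤
        13 / 4 * errG M' (R' T) T mu (2 * L + 1) := by
      simp only [errG]
      rw [abs_of_nonneg (by positivity : (0 : ℝ) ≤ |α| + 2 * |(L : ℝ)|)]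
      have t1 : 1 / (mu ^ 2 * M') ≤ 13 / 4 * (1 / (mu ^ 2 * M')) := by
        have : 0 ≤ 1 / (mu ^ 2 * M') := by positivity
        linarith
      have t2 : (|α| + 2 * |(L : ℝ)| + 1) * M' ^ 2 * R' T ≤
          13 / 4 * ((|(2 * L + 1 : ℝ)| + 1) * M' ^ 2 * R' T) := by
        have hMR : 0 ≤ M' ^ 2 * R' T := by positivity
        have hcoef : |α| + 2 * |(L : ℝ)| + 1 ≤ 13 / 4 * (|(2 * L + 1 : ℝ)| + 1) := by
          have : 0 ≤ |(2 * L + 1 : ℝ)| := abs_nonneg _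
          linarith
        have := mul_le_mul_of_nonneg_right hcoef hMR
        linarith [this]
      have t3 : 1 / Real.log T ≤ 13 / 4 * (1 / Real.log T) := by
        have : 0 ≤ 1 / Real.log T := by positivity
        linarith
      linarith
    calc ‖heathBrownG mu (α + 2 * L) T - heathBrownG mu α T‖
        = |heathBrownG mu (α + 2 * L) T - heathBrownG mu α T| := Real.norm_eq_abs _
      _ ≤ C₂ * errG M' (R' T) T mu (|α| + 2 * |(L : ℝ)|) := h1
      _ ≤ |C₂| * errG M' (R' T) T mu (|α| + 2 * |(L : ℝ)|) := h2
      _ ≤ |C₂| * (13 / 4 * errG M' (R' T) T mu (2 * L + 1)) :=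
          mul_le_mul_of_nonneg_left h3 (abs_nonneg _)
      _ = 13 / 4 * |C₂| * errG M' (R' T) T mu (2 * L + 1) := by ring
  have h := intervalIntegral.norm_integral_le_of_norm_le_const hbound
  rw [Real.norm_eq_abs, show (1 : ℝ) + mu - (1 - mu) = 2 * mu by ring,
    abs_of_pos (by linarith : (0 : ℝ) < 2 * mu)] at h
  calc |∫ α in (1 - mu)..(1 + mu), (heathBrownG mu (α + 2 * L) T - heathBrownG mu α T)|
      ≤ 13 / 4 * |C₂| * errG M' (R' T) T mu (2 * L + 1) * (2 * mu) := h
    _ = 13 / 2 * |C₂| * mu * errG M' (R' T) T mu (2 * L + 1) := by ring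


/-- **Lemma 6 (iii), LOWER half, every odd `K`, CORE form** (the tree's
`bgstb2025_lemma6_iii_lower_odd` re-run verbatim with Corollary 5 (constant `C`) and the transport
(constant `C₂`) abstracted at level `M'`, rate `R'`, bins at `Mb`): for all large `T`, `0 < λ ≤ 1/2`,
odd `K`, `2(P₀ − 1) − (4|C| + |C₂|)(λ + E_G(λ/2, K) + 1/(λ²√log T)) ≤ ∫_{K−λ}^{K+λ} F`. OURS (sound
replacement of the printed (iii), E-ah-5).
[cite: BaluyotGoldstonSuriajayaTurnageButterbaugh2025, Lemma 6 (iii)] -/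
theorem AH.lemma6_iii_lower_odd_core {C C₂ Mb M' δ : ℝ} {R' : ℝ → ℝ} (hM' : 0 < M')
    (hR0 : ∀ T, 0 < R' T)
    (hC : ∀ᶠ T : ℝ in atTop, ∀ lam : ℝ, 0 < lam → lam ≤ 1 / 4 →
      |(∫ α in (1 - lam)..(1 + lam), AH.heathBrownG lam α T) - 2 * (AH.binDensity 0 T Mb δ - 1)| ≤
        C * (lam + AH.errG M' (R' T) T lam 1 + 1 / (lam ^ 2 * Real.sqrt (Real.log T))))
    (hC₂ : ∀ᶠ T : ℝ in atTop, ∀ mu : ℝ, 0 < mu → mu ≤ 1 / 4 → ∀ L : ℤ,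
      |(∫ α in ((2 * L + 1 : ℝ) - mu)..((2 * L + 1 : ℝ) + mu), AH.heathBrownG mu α T) -
          ∫ α in (1 - mu)..(1 + mu), AH.heathBrownG mu α T| ≤
        C₂ * mu * AH.errG M' (R' T) T mu (2 * L + 1)) :
    ∀ᶠ T : ℝ in atTop, ∀ lam : ℝ, 0 < lam → lam ≤ 1 / 2 → ∀ K : ℤ, Odd K →
      2 * (AH.binDensity 0 T Mb δ - 1) -
          (4 * |C| + |C₂|) *
            (lam + AH.errG M' (R' T) T (lam / 2) K + 1 / (lam ^ 2 * Real.sqrt (Real.log T))) ≤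
        ∫ β in (K - lam)..(K + lam), montgomeryFormFactor β T := by
  filter_upwards [hC, hC₂, eventually_gt_atTop (1 : ℝ)] with T hT hT₂ hT1 lam hlam hlam2 K hK
  obtain ⟨L, rfl⟩ := hK
  push_cast
  have hlog : 0 < Real.log T := Real.log_pos hT1
  have hsq : 0 < Real.sqrt (Real.log T) := Real.sqrt_pos.mpr hlog
  have hRT : 0 < R' T := hR0 T
  set mu : ℝ := lam / 2 with hmu_def
  have hmu : 0 < mu := by rw [hmu_def]; linarith
  have hmu4 : mu ≤ 1 / 4 := by rw [hmu_def]; linarith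
  -- the three inputs
  have h5 := hT mu hmu hmu4
  have htr := hT₂ mu hmu hmu4 L
  have hwin := AH.integral_heathBrownG_le_window hmu hT1 (2 * (L : ℝ) + 1)
  rw [show 2 * mu = lam by rw [hmu_def]; ring] at hwin
  -- bookkeeping of the error terms
  have hK1 : (1 : ℝ) ≤ |(2 * L + 1 : ℝ)| := by
    have h : (1 : ℤ) ≤ |2 * L + 1| := Int.one_le_abs (by omega)
    have h' := (Int.cast_le (R := ℝ)).mpr h
    push_cast [Int.cast_abs] at h'
    exact h'
  have hEK : 0 ≤ AH.errG M' (R' T) T mu (2 * L + 1) := by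
    simp only [AH.errG]
    positivity
  have hE1 : AH.errG M' (R' T) T mu 1 ≤ AH.errG M' (R' T) T mu (2 * L + 1) := by
    simp only [AH.errG, abs_one]
    have hMR : 0 ≤ M' ^ 2 * R' T := by positivity
    nlinarith
  have hZ : 0 ≤ 1 / (lam ^ 2 * Real.sqrt (Real.log T)) := by positivity
  have hY : 1 / (mu ^ 2 * Real.sqrt (Real.log T)) = 4 * (1 / (lam ^ 2 * Real.sqrt (Real.log T))) := by
    rw [hmu_def]
    field_simp
    ring
  have hS : 0 ≤ mu + AH.errG M' (R' T) T mu 1 + 1 / (mu ^ 2 * Real.sqrt (Real.log T)) := by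
    have : 0 ≤ AH.errG M' (R' T) T mu 1 := by
      simp only [AH.errG]
      positivity
    positivity
  -- pass to `|C|`, `|C₂|`
  have h5' : 2 * (AH.binDensity 0 T Mb δ - 1) -
      |C| * (mu + AH.errG M' (R' T) T mu 1 + 1 / (mu ^ 2 * Real.sqrt (Real.log T))) ≤
        ∫ α in (1 - mu)..(1 + mu), AH.heathBrownG mu α T := by
    have := (abs_le.mp (h5.trans (mul_le_mul_of_nonneg_right (le_abs_self C) hS))).1
    linarith
  have htr' : (∫ α in (1 - mu)..(1 + mu), AH.heathBrownG mu α T) - |C₂| * mu *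
      AH.errG M' (R' T) T mu (2 * L + 1) ≤
        ∫ α in ((2 * L + 1 : ℝ) - mu)..((2 * L + 1 : ℝ) + mu), AH.heathBrownG mu α T := by
    have := (abs_le.mp (htr.trans
      (mul_le_mul_of_nonneg_right (mul_le_mul_of_nonneg_right (le_abs_self C₂) hmu.le) hEK))).1
    linarith
  -- comparison of the error shapes
  have hc1 : mu + AH.errG M' (R' T) T mu 1 + 1 / (mu ^ 2 * Real.sqrt (Real.log T)) ≤
      4 * (lam + AH.errG M' (R' T) T mu (2 * L + 1) + 1 / (lam ^ 2 * Real.sqrt (Real.log T))) := by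
    rw [hY, hmu_def] at *
    linarith
  have hc2 : mu * AH.errG M' (R' T) T mu (2 * L + 1) ≤
      lam + AH.errG M' (R' T) T mu (2 * L + 1) + 1 / (lam ^ 2 * Real.sqrt (Real.log T)) := by
    have := mul_le_mul_of_nonneg_right hmu4 hEK
    linarith
  have p1 := mul_le_mul_of_nonneg_left hc1 (abs_nonneg C)
  have p2 := mul_le_mul_of_nonneg_left hc2 (abs_nonneg C₂)
  linarith


/-- **Lemma 6 (iii), UPPER half, every odd `K`, CORE form** (the tree's
`bgstb2025_lemma6_iii_upper_odd` re-run verbatim with Corollary 5 (constant `C`) and the transport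
(constant `C₂`) abstracted at level `M'`, rate `R'`, bins at `Mb`; `G_μ ≥ 0` from RH): for all large
`T`, `0 < λ ≤ μ ≤ 1/4`, odd `K`,
`∫_{K−λ}^{K+λ} F ≤ (1 + λ²/μ²)(2(P₀ − 1) + (|C| + |C₂|)(μ + E_G(μ, K) + 1/(μ²√log T)))`. OURS (sound
replacement of the printed (iii), E-ah-5).
[cite: BaluyotGoldstonSuriajayaTurnageButterbaugh2025, Lemma 6 (iii)] -/
theorem AH.lemma6_iii_upper_odd_core (hRH : RiemannHypothesis) {C C₂ Mb M' δ : ℝ} {R' : ℝ → ℝ}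
    (hM' : 0 < M') (hR0 : ∀ T, 0 < R' T)
    (hC : ∀ᶠ T : ℝ in atTop, ∀ lam : ℝ, 0 < lam → lam ≤ 1 / 4 →
      |(∫ α in (1 - lam)..(1 + lam), AH.heathBrownG lam α T) - 2 * (AH.binDensity 0 T Mb δ - 1)| ≤
        C * (lam + AH.errG M' (R' T) T lam 1 + 1 / (lam ^ 2 * Real.sqrt (Real.log T))))
    (hC₂ : ∀ᶠ T : ℝ in atTop, ∀ mu : ℝ, 0 < mu → mu ≤ 1 / 4 → ∀ L : ℤ,
      |(∫ α in ((2 * L + 1 : ℝ) - mu)..((2 * L + 1 : ℝ) + mu), AH.heathBrownG mu α T) -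
          ∫ α in (1 - mu)..(1 + mu), AH.heathBrownG mu α T| ≤
        C₂ * mu * AH.errG M' (R' T) T mu (2 * L + 1)) :
    ∀ᶠ T : ℝ in atTop, ∀ lam mu : ℝ, 0 < lam → lam ≤ mu → mu ≤ 1 / 4 →
      ∀ K : ℤ, Odd K →
        ∫ β in (K - lam)..(K + lam), montgomeryFormFactor β T ≤
          (1 + lam ^ 2 / mu ^ 2) * (2 * (AH.binDensity 0 T Mb δ - 1) +
            (|C| + |C₂|) * (mu + AH.errG M' (R' T) T mu K + 1 / (mu ^ 2 * Real.sqrt (Real.log T)))) := by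
  have hG0 := (bgstb2025_lemma5_rh_holds hRH).1
  filter_upwards [hC, hC₂, eventually_gt_atTop (1 : ℝ)] with T hT hT₂ hT1 lam mu hlam hlm hmu4
    K hK
  obtain ⟨L, rfl⟩ := hK
  push_cast
  have hmu : 0 < mu := lt_of_lt_of_le hlam hlm
  have hlog : 0 < Real.log T := Real.log_pos hT1
  have hsq : 0 < Real.sqrt (Real.log T) := Real.sqrt_pos.mpr hlog
  have hRT : 0 < R' T := hR0 T
  -- the inputs
  have h5 := hT mu hmu hmu4
  have htr := hT₂ mu hmu hmu4 L
  have hmaj := AH.sq_sub_mul_integral_window_le hlam hlm hT1 (2 * (L : ℝ) + 1)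
  have hX0 : 0 ≤ ∫ α in ((2 * L + 1 : ℝ) - mu)..((2 * L + 1 : ℝ) + mu), AH.heathBrownG mu α T :=
    intervalIntegral.integral_nonneg (by linarith) fun α _ ↦ hG0 mu α T hmu (by linarith) hT1
  -- error bookkeeping
  have hEK : 0 ≤ AH.errG M' (R' T) T mu (2 * L + 1) := by
    simp only [AH.errG]
    positivity
  have hE1 : AH.errG M' (R' T) T mu 1 ≤ AH.errG M' (R' T) T mu (2 * L + 1) := by
    have hK1 : (1 : ℝ) ≤ |(2 * L + 1 : ℝ)| := by
      have h : (1 : ℤ) ≤ |2 * L + 1| := Int.one_le_abs (by omega)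
      have h' := (Int.cast_le (R := ℝ)).mpr h
      push_cast [Int.cast_abs] at h'
      exact h'
    simp only [AH.errG, abs_one]
    have hMR : 0 ≤ M' ^ 2 * R' T := by positivity
    nlinarith
  have hS : 0 ≤ mu + AH.errG M' (R' T) T mu 1 + 1 / (mu ^ 2 * Real.sqrt (Real.log T)) := by
    have : 0 ≤ AH.errG M' (R' T) T mu 1 := by
      simp only [AH.errG]
      positivity
    positivity
  set B : ℝ := 2 * (AH.binDensity 0 T Mb δ - 1) +
    (|C| + |C₂|) * (mu + AH.errG M' (R' T) T mu (2 * L + 1) + 1 / (mu ^ 2 * Real.sqrt (Real.log T)))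
    with hB
  -- `X_K ≤ B`
  have h5' : (∫ α in (1 - mu)..(1 + mu), AH.heathBrownG mu α T) ≤ 2 * (AH.binDensity 0 T Mb δ - 1) +
      |C| * (mu + AH.errG M' (R' T) T mu 1 + 1 / (mu ^ 2 * Real.sqrt (Real.log T))) := by
    have := (abs_le.mp (h5.trans (mul_le_mul_of_nonneg_right (le_abs_self C) hS))).2
    linarith
  have htr' : (∫ α in ((2 * L + 1 : ℝ) - mu)..((2 * L + 1 : ℝ) + mu), AH.heathBrownG mu α T) ≤
      (∫ α in (1 - mu)..(1 + mu), AH.heathBrownG mu α T) +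
        |C₂| * mu * AH.errG M' (R' T) T mu (2 * L + 1) := by
    have := (abs_le.mp (htr.trans
      (mul_le_mul_of_nonneg_right (mul_le_mul_of_nonneg_right (le_abs_self C₂) hmu.le) hEK))).2
    linarith
  have hXB : (∫ α in ((2 * L + 1 : ℝ) - mu)..((2 * L + 1 : ℝ) + mu), AH.heathBrownG mu α T) ≤ B := by
    rw [hB]
    have p1 := mul_le_mul_of_nonneg_left hE1 (abs_nonneg C)
    have p2 : |C₂| * mu * AH.errG M' (R' T) T mu (2 * L + 1) ≤
        |C₂| * AH.errG M' (R' T) T mu (2 * L + 1) := by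
      have := mul_le_mul_of_nonneg_right hmu4 hEK
      have := mul_le_mul_of_nonneg_left this (abs_nonneg C₂)
      nlinarith [abs_nonneg C₂]
    have p3 : 0 ≤ |C₂| * (mu + 1 / (mu ^ 2 * Real.sqrt (Real.log T))) := by positivity
    nlinarith [p1, p2, p3, h5', htr']
  -- `∫ F ≤ (1 + λ²/μ²) X_K`
  have hpos : 0 < mu ^ 2 - lam ^ 2 / 2 := by
    have : lam ^ 2 ≤ mu ^ 2 := pow_le_pow_left₀ hlam.le hlm 2
    nlinarith [pow_pos hmu 2]
  have ht : lam ^ 2 / mu ^ 2 ≤ 1 := by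
    rw [div_le_one (by positivity)]
    exact pow_le_pow_left₀ hlam.le hlm 2
  have hkey : (mu ^ 2 - lam ^ 2 / 2) *
      ∫ β in ((2 * L + 1 : ℝ) - lam)..((2 * L + 1 : ℝ) + lam), montgomeryFormFactor β T ≤
      (mu ^ 2 - lam ^ 2 / 2) * ((1 + lam ^ 2 / mu ^ 2) *
        ∫ α in ((2 * L + 1 : ℝ) - mu)..((2 * L + 1 : ℝ) + mu), AH.heathBrownG mu α T) := by
    refine hmaj.trans ?_
    have e : (mu ^ 2 - lam ^ 2 / 2) * ((1 + lam ^ 2 / mu ^ 2) *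
        ∫ α in ((2 * L + 1 : ℝ) - mu)..((2 * L + 1 : ℝ) + mu), AH.heathBrownG mu α T) -
        mu ^ 2 * ∫ α in ((2 * L + 1 : ℝ) - mu)..((2 * L + 1 : ℝ) + mu), AH.heathBrownG mu α T =
        lam ^ 2 / 2 * (1 - lam ^ 2 / mu ^ 2) *
          ∫ α in ((2 * L + 1 : ℝ) - mu)..((2 * L + 1 : ℝ) + mu), AH.heathBrownG mu α T := by
      field_simp
      ring
    have : 0 ≤ lam ^ 2 / 2 * (1 - lam ^ 2 / mu ^ 2) *
        ∫ α in ((2 * L + 1 : ℝ) - mu)..((2 * L + 1 : ℝ) + mu), AH.heathBrownG mu α T :=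
      mul_nonneg (mul_nonneg (by positivity) (sub_nonneg.mpr ht)) hX0
    linarith
  have hI := le_of_mul_le_mul_left hkey hpos
  refine hI.trans ?_
  exact mul_le_mul_of_nonneg_left hXB (by positivity)


/-- Radii `λ − λ² ≤ μ ≤ λ + λ²` with `0 < λ ≤ 1/4` (arithmetic). [folklore] -/
private theorem u6_ii_radius {lam μ : ℝ} (hlam : 0 < lam) (hlam4 : lam ≤ 1 / 4)
    (hμ1 : lam - lam ^ 2 ≤ μ) (hμ2 : μ ≤ lam + lam ^ 2) :
    0 < μ ∧ μ ≤ 2 * lam ∧ μ ^ 2 ≤ 2 * lam ^ 2 ∧ lam ^ 2 ≤ 2 * μ ^ 2 := by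
  have hl2 : lam ^ 2 ≤ lam / 4 := by nlinarith
  have hμ0 : 0 < μ := by nlinarith
  have hμ34 : 3 / 4 * lam ≤ μ := by nlinarith
  refine ⟨hμ0, by nlinarith, by nlinarith, by nlinarith⟩

/-- The error shape of Lemma 6 (ii) after the differencing at `h = λ²` (arithmetic). [folklore] -/
private theorem u6_ii_err_shape {lam μ s l E A B : ℝ} (hlam : 0 < lam) (hlam4 : lam ≤ 1 / 4)
    (hμ1 : lam - lam ^ 2 ≤ μ) (hμ2 : μ ≤ lam + lam ^ 2) (hs : 1 ≤ s) (hsl : s ≤ l)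
    (hE : 0 ≤ E) (hA : 0 ≤ A) (hB : 0 ≤ B) :
    A * (μ ^ 2 / s + 1 / l) + B * μ ^ 2 * (2 * E) ≤
      2 * lam ^ 3 * ((2 * (A + B)) * (lam + 1 / (lam ^ 5 * s) + E / lam)) := by
  obtain ⟨hμ0, -, hμle, -⟩ := u6_ii_radius hlam hlam4 hμ1 hμ2
  have hs0 : 0 < s := by linarith
  have hl0 : 0 < l := by linarith
  have hl1 : lam ≤ 1 := by linarith
  have hl4 : lam ^ 4 ≤ 1 := pow_le_one₀ hlam.le hl1
  -- `μ²/s ≤ 2/(λ² s)`, `1/l ≤ 1/s ≤ 2/(λ² s)`, `B μ² 2E ≤ 4 B λ² E`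
  set X : ℝ := 1 / (lam ^ 2 * s) with hX
  have hX0 : 0 ≤ X := by positivity
  have t1 : μ ^ 2 / s ≤ 2 * X := by
    rw [hX, div_le_iff₀ hs0, show 2 * (1 / (lam ^ 2 * s)) * s = 2 / lam ^ 2 by field_simp,
      le_div_iff₀ (by positivity)]
    calc μ ^ 2 * lam ^ 2 ≤ 2 * lam ^ 2 * lam ^ 2 := by gcongr
      _ = 2 * lam ^ 4 := by ring
      _ ≤ 2 * 1 := by gcongr
      _ = 2 := by ring
  have t2 : 1 / l ≤ 2 * X := by
    have h1 : 1 / l ≤ 1 / s := one_div_le_one_div_of_le hs0 hsl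
    have h2 : 1 / s ≤ 2 * X := by
      rw [hX, show 2 * (1 / (lam ^ 2 * s)) = (2 / lam ^ 2) * (1 / s) by field_simp]
      have : (1 : ℝ) ≤ 2 / lam ^ 2 := by
        rw [le_div_iff₀ (by positivity)]
        nlinarith
      have hs' : 0 ≤ 1 / s := by positivity
      nlinarith
    linarith
  have t3 : μ ^ 2 * (2 * E) ≤ 4 * (lam ^ 2 * E) := by nlinarith
  have p1 : A * (μ ^ 2 / s + 1 / l) ≤ A * (4 * X) := by
    have := add_le_add t1 t2
    have := mul_le_mul_of_nonneg_left this hA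
    linarith
  have p2 : B * μ ^ 2 * (2 * E) ≤ B * (4 * (lam ^ 2 * E)) := by
    rw [mul_assoc]
    exact mul_le_mul_of_nonneg_left t3 hB
  have q1 : 0 ≤ A * lam ^ 4 := by positivity
  have q2 : 0 ≤ A * (lam ^ 2 * E) := by positivity
  have q3 : 0 ≤ B * lam ^ 4 := by positivity
  have q4 : 0 ≤ B * X := by positivity
  have expand : 2 * lam ^ 3 * ((2 * (A + B)) * (lam + 1 / (lam ^ 5 * s) + E / lam)) =
      4 * (A * lam ^ 4) + 4 * (B * lam ^ 4) + 4 * (A * X) + 4 * (B * X) +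
        4 * (A * (lam ^ 2 * E)) + 4 * (B * (lam ^ 2 * E)) := by
    rw [hX]
    field_simp
    ring
  rw [expand]
  have eA : A * (4 * X) = 4 * (A * X) := by ring
  have eB : B * (4 * (lam ^ 2 * E)) = 4 * (B * (lam ^ 2 * E)) := by ring
  linarith

/-- Final bookkeeping of Lemma 6 (ii) (arithmetic). [folklore] -/
private theorem u6_ii_final {lam t c S : ℝ} (hlam : 0 < lam) (ht : t ≤ 1) (hc : 0 ≤ c)
    (hS : lam ≤ S) :
    lam / 2 * t + 2 * (2 * c * S) ≤ (8 * c + 1) * S := by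
  have hS0 : 0 ≤ S := hlam.le.trans hS
  nlinarith


/-- **Lemma 6 (ii), CORE form** (the tree's `bgstb2025_lemma6_ii` re-run verbatim with Lemma 5
(ii) (constant `C₁`) and Lemma 5 (iv) (`C₂ · E_G` at level `M'`, rate `R'`) abstracted): for all large
`T`, `0 < λ ≤ 1/4`, `L ∈ ℤ`, `2λ ≤ |α − 2L| ≤ 1 − 2λ`,
`|(1/2λ)∫_{α−λ}^{α+λ} F − s(α)| ≤ (8(|C₁| + |C₂|) + 1)(λ + 1/(λ⁵√log T) + E_G(λ, L)/λ)`. Printed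
(ii): "`(1/2λ) ∫_{α−λ}^{α+λ} F(β) dβ = s(α) + O(λ) + O(1/(λ⁵ √log T)) + O((1/λ) E_G(λ, L))`".
[cite: BaluyotGoldstonSuriajayaTurnageButterbaugh2025, Lemma 6 (ii)] -/
theorem AH.lemma6_ii_core {C₁ C₂ M' : ℝ} {R' : ℝ → ℝ} (hM' : 0 < M') (hR0 : ∀ T, 0 < R' T)
    (h₁ : ∀ᶠ T : ℝ in atTop, ∀ lam : ℝ, 0 < lam → lam ≤ 1 / 2 → ∀ α : ℝ,
      (|α| < lam →
        |AH.heathBrownG lam α T - (lam - |α|) / lam ^ 2| ≤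
          C₁ * (lam + 1 / (lam * Real.sqrt (Real.log T)) + 1 / (lam ^ 2 * Real.log T))) ∧
      (lam ≤ |α| → |α| ≤ 1 - lam →
        abs (AH.heathBrownG lam α T - |α|) ≤
          C₁ * (1 / Real.sqrt (Real.log T) + 1 / (lam ^ 2 * Real.log T))))
    (h₂ : ∀ᶠ T : ℝ in atTop, ∀ lam : ℝ, 0 < lam → lam ≤ 1 / 2 → ∀ α : ℝ, ∀ L : ℤ,
      |AH.heathBrownG lam (α + 2 * L) T - AH.heathBrownG lam α T| ≤
        C₂ * AH.errG M' (R' T) T lam (|α| + 2 * |(L : ℝ)|)) :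
    ∀ᶠ T : ℝ in atTop, ∀ lam : ℝ, 0 < lam → lam ≤ 1 / 4 → ∀ L : ℤ, ∀ α : ℝ,
      2 * lam ≤ |α - 2 * L| → |α - 2 * L| ≤ 1 - 2 * lam →
        |1 / (2 * lam) * (∫ β in (α - lam)..(α + lam), montgomeryFormFactor β T) -
            triangleWave α| ≤
          (8 * (|C₁| + |C₂|) + 1) *
            (lam + 1 / (lam ^ 5 * Real.sqrt (Real.log T)) + AH.errG M' (R' T) T lam L / lam) := by
  filter_upwards [h₁, h₂, eventually_gt_atTop (1 : ℝ),
    Real.tendsto_log_atTop.eventually (eventually_ge_atTop (1 : ℝ))] with T hT₁ hT₂ hT1 hlogT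
    lam hlam hlam4 L α hαlo hαhi
  have hlog0 : 0 < Real.log T := by linarith
  have hsq1 : 1 ≤ Real.sqrt (Real.log T) := by
    rw [show (1 : ℝ) = Real.sqrt 1 by simp]
    exact Real.sqrt_le_sqrt hlogT
  have hsq0 : 0 < Real.sqrt (Real.log T) := by linarith
  have hsqle : Real.sqrt (Real.log T) ≤ Real.log T := by
    have h := Real.sq_sqrt hlog0.le
    nlinarith
  have hRT : 0 ≤ R' T := (hR0 T).le
  have hl1 : lam ≤ 1 := by linarith
  -- `α* = α − 2L`, `s(α) = |α*|`
  set a : ℝ := α - 2 * L with ha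
  have hs : triangleWave α = |a| := by
    have : α = a + 2 * L := by rw [ha]; ring
    rw [this, triangleWave_add_two_mul_int, triangleWave_of_abs_le_one (by linarith)]
  rw [hs]
  have ha1 : |a| ≤ 1 := by linarith
  set E : ℝ := AH.errG M' (R' T) T lam L with hE
  have hE0 : 0 ≤ E := by
    simp only [hE, AH.errG]
    positivity
  set H : ℝ → ℝ := fun μ ↦ μ ^ 2 * AH.heathBrownG μ α T with hH
  -- `|H μ − μ² |a|| ≤ Δ(μ)` for `λ − λ² ≤ μ ≤ λ + λ²`
  have hΔ : ∀ μ : ℝ, lam - lam ^ 2 ≤ μ → μ ≤ lam + lam ^ 2 →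
      abs (H μ - μ ^ 2 * |a|) ≤
        |C₁| * (μ ^ 2 / Real.sqrt (Real.log T) + 1 / Real.log T) + |C₂| * μ ^ 2 * (2 * E) := by
    intro μ hμ1 hμ2
    obtain ⟨hμ0, hμ2l, -, hl2μ⟩ := u6_ii_radius hlam hlam4 hμ1 hμ2
    have hμ12 : μ ≤ 1 / 2 := by linarith
    have hμa : μ ≤ |a| := by linarith
    have hμa' : |a| ≤ 1 - μ := by linarith
    -- Lemma 5 (ii) at `a`, radius `μ`
    have hii := (hT₁ μ hμ0 hμ12 a).2 hμa hμa'
    -- Lemma 5 (iv): `G_μ(a + 2L) = G_μ(a) + O(E_G(μ, |a| + 2|L|))`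
    have hiv := hT₂ μ hμ0 hμ12 a L
    have hαa : a + 2 * L = α := by rw [ha]; ring
    rw [hαa] at hiv
    -- `E_G(μ, |a| + 2|L|) ≤ 2 E`
    have hEμ : AH.errG M' (R' T) T μ (|a| + 2 * |(L : ℝ)|) ≤ 2 * E := by
      simp only [hE, AH.errG]
      rw [abs_of_nonneg (by positivity : (0 : ℝ) ≤ |a| + 2 * |(L : ℝ)|)]
      have h1 : 1 / (μ ^ 2 * M') ≤ 2 * (1 / (lam ^ 2 * M')) := by
        rw [div_le_iff₀ (by positivity), show 2 * (1 / (lam ^ 2 * M')) * (μ ^ 2 * M') =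
          2 * μ ^ 2 / lam ^ 2 by field_simp]
        rw [le_div_iff₀ (by positivity), one_mul]
        exact hl2μ
      have h2 : (|a| + 2 * |(L : ℝ)| + 1) * M' ^ 2 * R' T ≤ 2 * ((|(L : ℝ)| + 1) * M' ^ 2 * R' T) := by
        have hMR : 0 ≤ M' ^ 2 * R' T := by positivity
        have hcoef : |a| + 2 * |(L : ℝ)| + 1 ≤ 2 * (|(L : ℝ)| + 1) := by linarith
        have := mul_le_mul_of_nonneg_right hcoef hMR
        linarith
      have h3 : 1 / Real.log T ≤ 2 * (1 / Real.log T) := by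
        have : 0 ≤ 1 / Real.log T := by positivity
        linarith
      linarith
    have hC₁ : C₁ * (1 / Real.sqrt (Real.log T) + 1 / (μ ^ 2 * Real.log T)) ≤
        |C₁| * (1 / Real.sqrt (Real.log T) + 1 / (μ ^ 2 * Real.log T)) :=
      mul_le_mul_of_nonneg_right (le_abs_self _) (by positivity)
    have hC₂ : C₂ * AH.errG M' (R' T) T μ (|a| + 2 * |(L : ℝ)|) ≤ |C₂| * (2 * E) := by
      calc C₂ * AH.errG M' (R' T) T μ (|a| + 2 * |(L : ℝ)|)
          ≤ |C₂| * AH.errG M' (R' T) T μ (|a| + 2 * |(L : ℝ)|) :=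
            mul_le_mul_of_nonneg_right (le_abs_self _) (by simp only [AH.errG]; positivity)
        _ ≤ |C₂| * (2 * E) := mul_le_mul_of_nonneg_left hEμ (abs_nonneg _)
    have hGa : abs (AH.heathBrownG μ a T - |a|) ≤
        |C₁| * (1 / Real.sqrt (Real.log T) + 1 / (μ ^ 2 * Real.log T)) := hii.trans hC₁
    have hGb : |AH.heathBrownG μ α T - AH.heathBrownG μ a T| ≤ |C₂| * (2 * E) := hiv.trans hC₂
    have hsplit : H μ - μ ^ 2 * |a| = μ ^ 2 * (AH.heathBrownG μ α T - AH.heathBrownG μ a T) +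
        μ ^ 2 * (AH.heathBrownG μ a T - |a|) := by
      simp only [hH]
      ring
    rw [hsplit]
    calc |μ ^ 2 * (AH.heathBrownG μ α T - AH.heathBrownG μ a T) +
          μ ^ 2 * (AH.heathBrownG μ a T - |a|)|
        ≤ μ ^ 2 * |AH.heathBrownG μ α T - AH.heathBrownG μ a T| +
          μ ^ 2 * abs (AH.heathBrownG μ a T - |a|) := by
          refine (abs_add_le _ _).trans ?_
          rw [abs_mul, abs_mul, abs_of_nonneg (sq_nonneg μ)]
      _ ≤ μ ^ 2 * (|C₂| * (2 * E)) +
          μ ^ 2 * (|C₁| * (1 / Real.sqrt (Real.log T) + 1 / (μ ^ 2 * Real.log T))) := by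
          gcongr
      _ = |C₁| * (μ ^ 2 / Real.sqrt (Real.log T) + 1 / Real.log T) + |C₂| * μ ^ 2 * (2 * E) := by
          field_simp
          ring
  -- each `Δ(μ)` is `≤ 2λ³ A`, `A = 2(|C₁| + |C₂|)(λ + 1/(λ⁵ √log T) + E/λ)`
  set A : ℝ := (2 * (|C₁| + |C₂|)) *
    (lam + 1 / (lam ^ 5 * Real.sqrt (Real.log T)) + E / lam) with hAdef
  have hΔ' : ∀ μ : ℝ, lam - lam ^ 2 ≤ μ → μ ≤ lam + lam ^ 2 →
      abs (H μ - μ ^ 2 * |a|) ≤ 2 * lam ^ 3 * A := fun μ hμ1 hμ2 ↦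
    (hΔ μ hμ1 hμ2).trans (u6_ii_err_shape hlam hlam4 hμ1 hμ2 hsq1 hsqle hE0 (abs_nonneg C₁)
      (abs_nonneg C₂))
  -- the differencing at `h = λ²`
  set I : ℝ := ∫ β in (-lam)..lam, montgomeryFormFactor (α + β) T with hI
  have hh : 0 < lam ^ 2 := by positivity
  have hhl : lam ^ 2 < lam := by nlinarith
  have hup := AH.integral_window_add_le hT1 hlam hh α
  have hlow := AH.integral_window_sub_le hT1 hh hhl α
  have hHlam : H lam = ∫ β in (-lam)..lam, (lam - |β|) * montgomeryFormFactor (α + β) T := by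
    simp only [hH]
    exact AH.sq_mul_heathBrownG hlam.ne' _ _
  have hHup : H (lam + lam ^ 2) =
      ∫ β in (-(lam + lam ^ 2))..(lam + lam ^ 2),
        (lam + lam ^ 2 - |β|) * montgomeryFormFactor (α + β) T := by
    simp only [hH]
    exact AH.sq_mul_heathBrownG (by positivity) _ _
  have hHlow : H (lam - lam ^ 2) =
      ∫ β in (-(lam - lam ^ 2))..(lam - lam ^ 2),
        (lam - lam ^ 2 - |β|) * montgomeryFormFactor (α + β) T := by
    simp only [hH]
    exact AH.sq_mul_heathBrownG (by linarith) _ _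
  rw [← hHlam, ← hHup] at hup
  rw [← hHlam, ← hHlow] at hlow
  -- `hup : λ² I + H λ ≤ H(λ + λ²)`, `hlow : H λ − λ² I ≤ H(λ − λ²)`
  have hb1 := hΔ' lam (by nlinarith) (by nlinarith)
  have hb2 := hΔ' (lam + lam ^ 2) (by nlinarith) le_rfl
  have hb3 := hΔ' (lam - lam ^ 2) le_rfl (by nlinarith)
  have hI1 : 1 / (2 * lam) * I - |a| ≤ lam / 2 * |a| + 2 * A := by
    have h1 := (abs_le.mp hb2).2
    have h2 := (abs_le.mp hb1).1
    have key : lam ^ 2 * I ≤ lam ^ 2 * ((2 * lam + lam ^ 2) * |a| + 4 * lam * A) := by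
      linarith
    have := le_of_mul_le_mul_left key hh
    rw [show 1 / (2 * lam) * I - |a| = (I - 2 * lam * |a|) / (2 * lam) by field_simp,
      div_le_iff₀ (by linarith)]
    linarith
  have hI2 : -(lam / 2 * |a| + 2 * A) ≤ 1 / (2 * lam) * I - |a| := by
    have h1 := (abs_le.mp hb1).1
    have h2 := (abs_le.mp hb3).2
    have key : lam ^ 2 * ((2 * lam - lam ^ 2) * |a| - 4 * lam * A) ≤ lam ^ 2 * I := by
      linarith
    have := le_of_mul_le_mul_left key hh
    rw [show 1 / (2 * lam) * I - |a| = (I - 2 * lam * |a|) / (2 * lam) by field_simp,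
      le_div_iff₀ (by linarith)]
    linarith
  -- rewrite the window integral and conclude
  have hIeq : (∫ β in (α - lam)..(α + lam), montgomeryFormFactor β T) = I := by
    rw [hI, intervalIntegral.integral_comp_add_left (fun β ↦ montgomeryFormFactor β T) α,
      sub_eq_add_neg]
  rw [hIeq]
  have hfin : abs (1 / (2 * lam) * I - |a|) ≤ lam / 2 * |a| + 2 * A := abs_le.mpr ⟨hI2, hI1⟩
  refine hfin.trans ?_
  rw [hAdef]
  have hS : lam ≤ lam + 1 / (lam ^ 5 * Real.sqrt (Real.log T)) + E / lam := by
    have : 0 ≤ 1 / (lam ^ 5 * Real.sqrt (Real.log T)) + E / lam := by positivity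
    linarith
  exact u6_ii_final hlam ha1 (add_nonneg (abs_nonneg C₁) (abs_nonneg C₂)) hS


/-- **Lemma 6 (ii), uniform in `α`, CORE form** (the tree's `bgstb2025_lemma6_ii_uniform` re-run
verbatim over `AH.lemma6_ii_core`'s output shape with constant `C`): for all large `T`, all
`0 < λ ≤ 1/4` and every `α` at distance `≥ 2λ` from `ℤ`,
`|(1/2λ)∫_{α−λ}^{α+λ} F − s(α)| ≤ |C|(λ + 1/(λ⁵√log T) + E_G(λ, |α| + 1)/λ)`.
[cite: BaluyotGoldstonSuriajayaTurnageButterbaugh2025, Lemma 6 (ii)] -/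
theorem AH.lemma6_ii_uniform_core {C M' : ℝ} {R' : ℝ → ℝ} (hM' : 0 < M') (hR0 : ∀ T, 0 < R' T)
    (hC : ∀ᶠ T : ℝ in atTop, ∀ lam : ℝ, 0 < lam → lam ≤ 1 / 4 → ∀ L : ℤ, ∀ α : ℝ,
      2 * lam ≤ |α - 2 * L| → |α - 2 * L| ≤ 1 - 2 * lam →
        |1 / (2 * lam) * (∫ β in (α - lam)..(α + lam), montgomeryFormFactor β T) -
            triangleWave α| ≤
          C * (lam + 1 / (lam ^ 5 * Real.sqrt (Real.log T)) + AH.errG M' (R' T) T lam L / lam)) :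
    ∀ᶠ T : ℝ in atTop, ∀ lam : ℝ, 0 < lam → lam ≤ 1 / 4 → ∀ α : ℝ,
      (∀ n : ℤ, 2 * lam ≤ |α - n|) →
        |1 / (2 * lam) * (∫ β in (α - lam)..(α + lam), montgomeryFormFactor β T) -
            triangleWave α| ≤
          |C| * (lam + 1 / (lam ^ 5 * Real.sqrt (Real.log T)) +
            AH.errG M' (R' T) T lam (|α| + 1) / lam) := by
  filter_upwards [hC, eventually_gt_atTop (1 : ℝ)] with T hT hT1 lam hlam hlam4 α hα
  have hlog : 0 < Real.log T := Real.log_pos hT1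
  have hRT : 0 < R' T := hR0 T
  -- `2L := 2 round(α/2)`
  set L : ℤ := round (α / 2) with hL
  have hr : |α / 2 - L| ≤ 1 / 2 := abs_sub_round (α / 2)
  have ha1 : |α - 2 * L| ≤ 1 := by
    rw [show α - 2 * (L : ℝ) = 2 * (α / 2 - L) by ring, abs_mul, abs_two]
    linarith
  have hlo : 2 * lam ≤ |α - 2 * L| := by
    have := hα (2 * L)
    push_cast at this
    exact this
  have hhi : |α - 2 * L| ≤ 1 - 2 * lam := by
    rcases le_or_gt 0 (α - 2 * L) with h0 | h0
    · have h1 := hα (2 * L + 1)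
      push_cast at h1
      rw [show α - (2 * (L : ℝ) + 1) = (α - 2 * L) - 1 by ring] at h1
      rw [abs_of_nonneg h0] at ha1 ⊢
      rw [abs_of_nonpos (by linarith)] at h1
      linarith
    · have h1 := hα (2 * L - 1)
      push_cast at h1
      rw [show α - (2 * (L : ℝ) - 1) = (α - 2 * L) + 1 by ring] at h1
      rw [abs_of_neg h0] at ha1 ⊢
      rw [abs_of_nonneg (by linarith)] at h1
      linarith
  have h := hT lam hlam hlam4 L α hlo hhi
  -- `E_G(λ, L) ≤ E_G(λ, |α| + 1)` and `C ≤ |C|`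
  have hEL : AH.errG M' (R' T) T lam L ≤ AH.errG M' (R' T) T lam (|α| + 1) := by
    simp only [AH.errG]
    have hL1 : |(L : ℝ)| ≤ |α| + 1 := by
      have : |(L : ℝ)| ≤ |α / 2| + 1 / 2 := by
        have := abs_sub_abs_le_abs_sub (L : ℝ) (α / 2)
        rw [abs_sub_comm] at this
        linarith
      rw [abs_div, abs_two] at this
      linarith [abs_nonneg α]
    have hMR : 0 ≤ M' ^ 2 * R' T := by positivity
    have : |(L : ℝ)| + 1 ≤ |(|α| + 1 : ℝ)| + 1 := by
      rw [abs_of_nonneg (by positivity : (0 : ℝ) ≤ |α| + 1)]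
      linarith
    nlinarith
  have hS0 : 0 ≤ lam + 1 / (lam ^ 5 * Real.sqrt (Real.log T)) + AH.errG M' (R' T) T lam L / lam := by
    have : 0 ≤ AH.errG M' (R' T) T lam L := by
      simp only [AH.errG]
      positivity
    positivity
  calc |1 / (2 * lam) * (∫ β in (α - lam)..(α + lam), montgomeryFormFactor β T) - triangleWave α|
      ≤ C * (lam + 1 / (lam ^ 5 * Real.sqrt (Real.log T)) + AH.errG M' (R' T) T lam L / lam) := h
    _ ≤ |C| * (lam + 1 / (lam ^ 5 * Real.sqrt (Real.log T)) + AH.errG M' (R' T) T lam L / lam) :=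
        mul_le_mul_of_nonneg_right (le_abs_self C) hS0
    _ ≤ |C| * (lam + 1 / (lam ^ 5 * Real.sqrt (Real.log T)) +
          AH.errG M' (R' T) T lam (|α| + 1) / lam) := by
        gcongr


/-- **The one-sided window at `1`, LOWER half, CORE form** (the tree's
`bgstb2025_lemma6_right_of_one_lower` re-run verbatim with the lower odd-`K` bound (constant `C`,
level `M'`, rate `R'`, bins at `Mb`) and Lemma 6 (iv) (constant `C₄`) abstracted): for all large `T`,
`0 < λ ≤ 1/4`, `2(P₀ − 1) − (|C| + |C₄|)(λ + E_G(λ/2, 1) + 1/(λ²√log T)) ≤ ∫_1^{1+λ} F`. OURS (sound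
replacement of the printed p. 15 conclusion, E-ah-5).
[cite: BaluyotGoldstonSuriajayaTurnageButterbaugh2025, §6, proof of Lemma 6 (iii)–(v)] -/
theorem AH.right_of_one_lower_core {C C₄ Mb M' δ : ℝ} {R' : ℝ → ℝ} (hM' : 0 < M')
    (hR0 : ∀ T, 0 < R' T)
    (hC : ∀ᶠ T : ℝ in atTop, ∀ lam : ℝ, 0 < lam → lam ≤ 1 / 2 → ∀ K : ℤ, Odd K →
      2 * (AH.binDensity 0 T Mb δ - 1) -
          C * (lam + AH.errG M' (R' T) T (lam / 2) K + 1 / (lam ^ 2 * Real.sqrt (Real.log T))) ≤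
        ∫ β in (K - lam)..(K + lam), montgomeryFormFactor β T)
    (hC₄ : ∀ᶠ T : ℝ in atTop, ∀ lam : ℝ, 0 < lam → lam ≤ 1 / 4 →
      |(∫ β in (1 - lam)..(1 + lam), montgomeryFormFactor β T) -
          ∫ β in (1 : ℝ)..(1 + lam), montgomeryFormFactor β T| ≤ C₄ * lam ∧
      |(∫ β in (-1 - lam)..(-1 + lam), montgomeryFormFactor β T) -
          ∫ β in (-1 - lam)..(-1 : ℝ), montgomeryFormFactor β T| ≤ C₄ * lam) :
    ∀ᶠ T : ℝ in atTop, ∀ lam : ℝ, 0 < lam → lam ≤ 1 / 4 →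
      2 * (AH.binDensity 0 T Mb δ - 1) -
          (|C| + |C₄|) *
            (lam + AH.errG M' (R' T) T (lam / 2) 1 + 1 / (lam ^ 2 * Real.sqrt (Real.log T))) ≤
        ∫ β in (1 : ℝ)..(1 + lam), montgomeryFormFactor β T := by
  filter_upwards [hC, hC₄, eventually_gt_atTop (1 : ℝ)] with T hT hT₄ hT1 lam hlam hlam4
  have hlog : 0 < Real.log T := Real.log_pos hT1
  have hRT : 0 < R' T := hR0 T
  have h1 := hT lam hlam (by linarith) 1 (by decide)
  push_cast at h1
  have h4 := (hT₄ lam hlam hlam4).1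
  set S : ℝ := lam + AH.errG M' (R' T) T (lam / 2) 1 + 1 / (lam ^ 2 * Real.sqrt (Real.log T))
    with hS
  have hE : 0 ≤ AH.errG M' (R' T) T (lam / 2) 1 := by
    simp only [AH.errG]
    positivity
  have hS0 : lam ≤ S := by
    have : 0 ≤ 1 / (lam ^ 2 * Real.sqrt (Real.log T)) := by positivity
    rw [hS]
    linarith
  have hSnn : 0 ≤ S := hlam.le.trans hS0
  have p1 : C * S ≤ |C| * S := mul_le_mul_of_nonneg_right (le_abs_self C) hSnn
  have p2 : C₄ * lam ≤ |C₄| * S :=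
    (mul_le_mul_of_nonneg_right (le_abs_self C₄) hlam.le).trans
      (mul_le_mul_of_nonneg_left hS0 (abs_nonneg C₄))
  have h4' := (abs_le.mp h4).2
  nlinarith [h1, h4', p1, p2]


/-- **The one-sided window at `1`, UPPER half, CORE form** (the tree's
`bgstb2025_lemma6_right_of_one_upper` re-run verbatim over the upper odd-`K` bound with constant
`C`, level `M'`, rate `R'`, bins at `Mb`): for all large `T`, `0 < λ ≤ μ ≤ 1/4`,
`∫_1^{1+λ} F ≤ (1 + λ²/μ²)(2(P₀ − 1) + C(μ + E_G(μ, 1) + 1/(μ²√log T)))`. OURS (E-ah-5 replacement).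
[cite: BaluyotGoldstonSuriajayaTurnageButterbaugh2025, §6, proof of Lemma 6 (iii)–(v)] -/
theorem AH.right_of_one_upper_core {C Mb M' δ : ℝ} {R' : ℝ → ℝ}
    (hC : ∀ᶠ T : ℝ in atTop, ∀ lam mu : ℝ, 0 < lam → lam ≤ mu → mu ≤ 1 / 4 →
      ∀ K : ℤ, Odd K →
        ∫ β in (K - lam)..(K + lam), montgomeryFormFactor β T ≤
          (1 + lam ^ 2 / mu ^ 2) * (2 * (AH.binDensity 0 T Mb δ - 1) +
            C * (mu + AH.errG M' (R' T) T mu K + 1 / (mu ^ 2 * Real.sqrt (Real.log T))))) :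
    ∀ᶠ T : ℝ in atTop, ∀ lam mu : ℝ, 0 < lam → lam ≤ mu → mu ≤ 1 / 4 →
      ∫ β in (1 : ℝ)..(1 + lam), montgomeryFormFactor β T ≤
        (1 + lam ^ 2 / mu ^ 2) * (2 * (AH.binDensity 0 T Mb δ - 1) +
          C * (mu + AH.errG M' (R' T) T mu 1 + 1 / (mu ^ 2 * Real.sqrt (Real.log T)))) := by
  filter_upwards [hC, eventually_gt_atTop (1 : ℝ)] with T hT hT1 lam mu hlam hlm hmu4
  have h1 := hT lam mu hlam hlm hmu4 1 (by decide)
  push_cast at h1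
  have hFc : Continuous fun β ↦ montgomeryFormFactor β T :=
    RudnickSarnak.continuous_montgomeryFormFactor T
  have hsplit := intervalIntegral.integral_add_adjacent_intervals
    (hFc.intervalIntegrable (μ := volume) (1 - lam) 1)
    (hFc.intervalIntegrable (μ := volume) 1 (1 + lam))
  have hleft : 0 ≤ ∫ β in (1 - lam)..(1 : ℝ), montgomeryFormFactor β T :=
    intervalIntegral.integral_nonneg (by linarith) fun β _ ↦
      Montgomery.montgomeryFormFactor_nonneg β hT1
  linarith


/-! ## §L. The M-free LIMIT forms (inputs of the Theorem-3 assembly), under RH and AH-Pairs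

Bookkeeping recipe (printed §7, p. 16: "we let `T → ∞` and then `M → ∞`", then the test function
forces `λ → 0`): given `ε`, pick `λ₀` against the ABSOLUTE `λ`-terms; for each `λ ≤ λ₀` pick the
AH-Pairs level `M = M(λ, ε)` killing `A/(λ^k M)` (AH-Pairs supplies every level); then `T₀(ε, λ, M)`
kills the `M`-dependent, `T`-vanishing terms. -/

/-- `E_G` at the rescaled level `M/A`, unpacked: `E_G'(λ, β) = A/(λ²M) + (|β| + 1)(M/A)²R' + 1/log T`.
[cite: BaluyotGoldstonSuriajayaTurnageButterbaugh2025, §5 (E_G)] -/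
theorem AH.errG_level_div {A M : ℝ} (hA : A ≠ 0) (hM : M ≠ 0) {lam : ℝ} (hlam : lam ≠ 0)
    (RT T β : ℝ) :
    AH.errG (M / A) RT T lam β =
      A / (lam ^ 2 * M) + ((|β| + 1) * (M / A) ^ 2 * RT + 1 / Real.log T) := by
  simp only [AH.errG]
  have e : 1 / (lam ^ 2 * (M / A)) = A / (lam ^ 2 * M) := by
    field_simp
  rw [e]
  ring

/-- **(W-P) `P₀(T)` is bounded under RH**, uniformly in the bin parameter: there is `P ≥ 0` with
`0 ≤ P₀(T, M, δ) ≤ P` for all large `T` and every `M` (`B₀ ⊆ 𝒫(T, δ/2)`, and the pair-window count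
`AH.card_pairs_le_window` from Montgomery's theorem). [cite: BaluyotGoldstonSuriajayaTurnageButterbaugh2025, §3 (P-bound)] -/
theorem AH.exists_binDensity_zero_le (hRH : RiemannHypothesis) {δ : ℝ} (hδ : 0 < δ) :
    ∃ P : ℝ, 0 ≤ P ∧ ∀ᶠ T : ℝ in atTop, ∀ M : ℝ,
      0 ≤ AH.binDensity 0 T M δ ∧ AH.binDensity 0 T M δ ≤ P := by
  obtain ⟨y₀, hy₀, C_w, hwinE⟩ := RudnickSarnak.exists_pairCount_window_le hRH
  set Cw : ℝ := max C_w 1 with hCw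
  have hCw0 : 0 < Cw := lt_of_lt_of_le one_pos (le_max_right _ _)
  refine ⟨2 * π * (2 * Cw * (⌊δ / 2 / y₀⌋₊ + 1)), by positivity, ?_⟩
  filter_upwards [hwinE, eventually_gt_atTop (1 : ℝ),
    Real.tendsto_log_atTop.eventually_ge_atTop (π * ((δ / 2 / y₀ + 5 / 2) * y₀))] with T hwin hT1 hLP M
  have hL : 0 < Real.log T := Real.log_pos hT1
  have hT0 : 0 < T := by linarith
  have hNm : 0 < T / (2 * π) * Real.log T := by positivity
  refine ⟨by unfold AH.binDensity; positivity, ?_⟩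
  have hwin' : ∀ s : ℝ, |s| + y₀ ≤ Real.log T / π →
      (((zeroIndexSet T ×ˢ zeroIndexSet T).filter fun p ↦
          |Real.log T / (2 * π) * (zetaOrdinate p.1 - zetaOrdinate p.2) - s| ≤ y₀).card : ℝ) ≤
        Cw * (T * Real.log T) := by
    intro s hs
    refine (hwin s hs).trans ?_
    exact mul_le_mul_of_nonneg_right (le_max_left _ _) (by positivity)
  have hLP' : (δ / 2 / y₀ + 5 / 2) * y₀ ≤ Real.log T / π := by
    rw [le_div_iff₀ Real.pi_pos]; linarith
  have hcard := AH.card_pairs_le_window (M := δ / 2) (by positivity) hy₀ hwin' hLP'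
  have hsub : AH.bin 0 T M δ ⊆ AH.pairs T (δ / 2) := by
    intro p hp
    rw [AH.mem_bin] at hp
    obtain ⟨hpP, h1, h2⟩ := hp
    rw [AH.mem_pairs] at hpP ⊢
    refine ⟨hpP.1, hpP.2.1, hpP.2.2.1, ?_⟩
    push_cast at h1 h2
    rw [abs_le]
    constructor <;> linarith
  unfold AH.binDensity
  rw [div_le_iff₀ hNm]
  calc ((AH.bin 0 T M δ).card : ℝ) ≤ (AH.pairs T (δ / 2)).card := by
        exact_mod_cast Finset.card_le_card hsub
    _ ≤ 2 * (Cw * (T * Real.log T)) * (⌊δ / 2 / y₀⌋₊ + 1) := hcard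
    _ = 2 * π * (2 * Cw * (⌊δ / 2 / y₀⌋₊ + 1)) * (T / (2 * π) * Real.log T) := by
        field_simp

/-- **The uniform AH-input at every level** (Lemma 5 (iii)–(iv), M-uniform, as ONE `E_G` with
leading constant `1`, v. `bgstb2025_lemma5_ah_usplit_errG`), with the rate made positive for all `T`
(`R'(T) = C(R(T) + 1/max(1, log T))`, which agrees with `C(R + 1/log T)` for `log T ≥ 1`): there is an
absolute `A > 0` such that at every AH-Pairs level `M` and every bin half-width `δ` there is a positive
rate `R' → 0` with, for all large `T`, all `0 < λ ≤ 1/2`, all `α`,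
`‖G_λ(α) − ∑_k …‖ ≤ 1 · E_G'` and `|G_λ(α + 2L) − G_λ(α)| ≤ 1 · E_G'(λ, |α| + 2|L|)`,
`E_G' = AH.errG (M/A) (R' T) T λ ·`. [cite: BaluyotGoldstonSuriajayaTurnageButterbaugh2025, Lemma 5 (iii)–(iv)] -/
theorem AH.exists_uniform_input (hRH : RiemannHypothesis) :
    ∃ A : ℝ, 0 < A ∧ ∀ M : ℝ, 0 < M → AHPairsAt M → ∀ δ : ℝ, 0 < δ → δ ≤ 1 / 2 →
      ∃ R' : ℝ → ℝ, (∀ T, 0 < R' T) ∧ Tendsto R' atTop (𝓝 0) ∧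
        ∀ᶠ T : ℝ in atTop, ∀ lam : ℝ, 0 < lam → lam ≤ 1 / 2 → ∀ α : ℝ,
          ‖(AH.heathBrownG lam α T : ℂ) -
              ∑' k : ℤ, Complex.exp (π * k * α * Complex.I) *
                ((Real.sinc (lam * π * k / 2) ^ 2 * AH.binDensity k T M δ : ℝ) : ℂ)‖ ≤
            1 * AH.errG (M / A) (R' T) T lam α ∧
          ∀ L : ℤ, |AH.heathBrownG lam (α + 2 * L) T - AH.heathBrownG lam α T| ≤
            1 * AH.errG (M / A) (R' T) T lam (|α| + 2 * |(L : ℝ)|) := by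
  obtain ⟨A, hA, h⟩ := bgstb2025_lemma5_ah_usplit_errG hRH
  refine ⟨A, hA, ?_⟩
  intro M hM hAHM δ hδ hδ2
  obtain ⟨R, hR⟩ := (ahPairsAt_iff M).mp hAHM
  obtain ⟨C, hC, hT⟩ := h M hM R hR δ hδ hδ2
  have hR0 : ∀ T, 0 < R T := hR.1
  have hRlim : Tendsto R atTop (𝓝 0) := hR.2.2.1
  refine ⟨fun T ↦ C * (R T + (max 1 (Real.log T))⁻¹), fun T ↦ ?_, ?_, ?_⟩
  · have := hR0 T
    positivity
  · have hmax : Tendsto (fun T : ℝ ↦ max 1 (Real.log T)) atTop atTop :=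
      Filter.tendsto_atTop_mono (fun T ↦ le_max_right _ _) Real.tendsto_log_atTop
    have h1 : Tendsto (fun T : ℝ ↦ (max 1 (Real.log T))⁻¹) atTop (𝓝 0) := hmax.inv_tendsto_atTop
    have h2 := (hRlim.add h1).const_mul C
    simpa using h2
  · filter_upwards [hT, Real.tendsto_log_atTop.eventually_ge_atTop (1 : ℝ)] with T hT' hlog
    intro lam hlam hlam2 α
    have hmax : max 1 (Real.log T) = Real.log T := max_eq_right hlog
    have h := hT' lam hlam hlam2 α
    rw [one_div] at h
    simp only [hmax, one_mul]
    exact h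

/-- `1/log T → 0`. [folklore] -/
private theorem u6_tendsto_one_div_log : Tendsto (fun T : ℝ ↦ 1 / Real.log T) atTop (𝓝 0) := by
  have h : Tendsto (fun T : ℝ ↦ (Real.log T)⁻¹) atTop (𝓝 0) :=
    Real.tendsto_log_atTop.inv_tendsto_atTop
  simpa [one_div] using h

/-- `c/√(log T) → 0`. [folklore] -/
private theorem u6_tendsto_const_div_sqrt_log (c : ℝ) :
    Tendsto (fun T : ℝ ↦ c / Real.sqrt (Real.log T)) atTop (𝓝 0) := by
  have h := ((Real.tendsto_sqrt_atTop.comp Real.tendsto_log_atTop).inv_tendsto_atTop).const_mul c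
  rw [mul_zero] at h
  refine h.congr' (Eventually.of_forall fun T ↦ ?_)
  simp only [Pi.inv_apply, Function.comp_apply, div_eq_mul_inv]

/-- Upper-half bookkeeping of the tent sandwich (pure arithmetic). [folklore] -/
private theorem u6_up_bookkeeping {W t p P Kup μ a Y ε : ℝ} (ht0 : 0 ≤ t) (ht1 : t ≤ 1)
    (hpP : p ≤ P) (htP : t * (2 * (P + 1)) ≤ ε / 4) (hK : 0 ≤ Kup) (hμ0 : 0 ≤ μ)
    (hμ : 2 * Kup * μ ≤ ε / 4) (ha0 : 0 ≤ a) (ha : 2 * Kup * a ≤ ε / 4) (hY0 : 0 ≤ Y)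
    (hY : 2 * Kup * Y < ε / 4) (hW : W ≤ (1 + t) * (2 * (p - 1) + Kup * (μ + a + Y))) :
    W ≤ 2 * (p - 1) + ε := by
  have h1 : t * (2 * (p - 1)) ≤ ε / 4 := by
    have : t * (2 * (p - 1)) ≤ t * (2 * (P + 1)) := by
      apply mul_le_mul_of_nonneg_left _ ht0
      linarith
    linarith
  have hX : 0 ≤ Kup * (μ + a + Y) := by positivity
  have h2 : (1 + t) * (Kup * (μ + a + Y)) ≤ 2 * (Kup * (μ + a + Y)) := by
    have := mul_le_mul_of_nonneg_right (show 1 + t ≤ 2 by linarith) hX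
    linarith
  have e : (1 + t) * (2 * (p - 1) + Kup * (μ + a + Y)) =
      2 * (p - 1) + t * (2 * (p - 1)) + (1 + t) * (Kup * (μ + a + Y)) := by ring
  have e2 : 2 * (Kup * (μ + a + Y)) = 2 * Kup * μ + 2 * Kup * a + 2 * Kup * Y := by ring
  linarith

/-- **(W-even) The windows at the even integers, M-free limit form** (Lemma 6 (i) under RH and
AH-Pairs, all constants eliminated): for every `L ∈ ℤ` and `ε > 0` there is `λ₀ > 0` such that for
every `0 < λ ≤ λ₀`, `|∫_{2L−λ}^{2L+λ} F(β, T) dβ − 1| ≤ ε` for all large `T`. Printed (i):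
"`∫_{2L−λ}^{2L+λ} F(β) dβ = 1 + O(λ²) + O(λ E_G(λ, L)) + O(1/(λ √log T))`"; OURS: the
`T → ∞`, then `M → ∞`, then `λ → 0` bookkeeping of §7 made explicit.
[cite: BaluyotGoldstonSuriajayaTurnageButterbaugh2025, Lemma 6 (i) and §7] -/
theorem AH.window_even_limit (hRH : RiemannHypothesis) (hAH : AHPairs) (L : ℤ) {ε : ℝ}
    (hε : 0 < ε) :
    ∃ lam0 : ℝ, 0 < lam0 ∧ ∀ lam : ℝ, 0 < lam → lam ≤ lam0 → ∀ᶠ T : ℝ in atTop,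
      |(∫ β in (2 * L - lam)..(2 * L + lam), montgomeryFormFactor β T) - 1| ≤ ε := by
  obtain ⟨A, hA, hU⟩ := AH.exists_uniform_input hRH
  obtain ⟨C₁, h₁⟩ := (bgstb2025_lemma5_rh_holds hRH).2
  obtain ⟨K, hK⟩ : ∃ K : ℝ, K = 100 * (|C₁| + |(1 : ℝ)|) := ⟨_, rfl⟩
  have hK0 : 0 < K := by rw [hK]; positivity
  refine ⟨min (1 / 4) (ε / (3 * K)), by positivity, ?_⟩
  intro lam hlam hlam0
  have hlam4 : lam ≤ 1 / 4 := hlam0.trans (min_le_left _ _)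
  have hlamε : lam ≤ ε / (3 * K) := hlam0.trans (min_le_right _ _)
  -- the AH level
  obtain ⟨M, hM⟩ : ∃ M : ℝ, M = 3 * K * A / (lam * ε) + 1 := ⟨_, rfl⟩
  have hM0 : 0 < M := by rw [hM]; positivity
  obtain ⟨R', hR0, hRlim, h₂⟩ := hU M hM0 (hAH M hM0) (1 / 2) (by norm_num) (by norm_num)
  have hM' : 0 < M / A := by positivity
  have hcore := AH.lemma6_i_core (C₂ := 1) hM' hR0 h₁
    (h₂.mono fun T hT lam hlam hlam2 α L ↦ (hT lam hlam hlam2 α).2 L)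
  -- the `T`-vanishing part
  have hg : Tendsto (fun T : ℝ ↦ K * (lam * ((|(L : ℝ)| + 1) * (M / A) ^ 2 * R' T +
      1 / Real.log T) + 1 / (lam * Real.sqrt (Real.log T)))) atTop (𝓝 0) := by
    have hs : Tendsto (fun T : ℝ ↦ 1 / (lam * Real.sqrt (Real.log T))) atTop (𝓝 0) := by
      have h := u6_tendsto_const_div_sqrt_log (1 / lam)
      refine h.congr' (Eventually.of_forall fun T ↦ ?_)
      rw [div_div]
    have h := ((((hRlim.const_mul ((|(L : ℝ)| + 1) * (M / A) ^ 2)).add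
      u6_tendsto_one_div_log).const_mul lam).add hs).const_mul K
    simp only [mul_zero, add_zero] at h
    exact h
  filter_upwards [hcore, hg.eventually (gt_mem_nhds (show (0 : ℝ) < ε / 3 by positivity)),
    eventually_gt_atTop (1 : ℝ)] with T hT hsmall hT1
  have hsmall' : K * (lam * ((|(L : ℝ)| + 1) * (M / A) ^ 2 * R' T + 1 / Real.log T) +
      1 / (lam * Real.sqrt (Real.log T))) < ε / 3 := hsmall
  have h := hT lam hlam hlam4 L
  rw [← hK, AH.errG_level_div hA.ne' hM0.ne' hlam.ne'] at h
  have h1 : K * lam ^ 2 ≤ ε / 3 := by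
    calc K * lam ^ 2 ≤ K * lam := by
          apply mul_le_mul_of_nonneg_left _ hK0.le
          nlinarith
      _ ≤ K * (ε / (3 * K)) := by gcongr
      _ = ε / 3 := by field_simp
  have h2 : K * (lam * (A / (lam ^ 2 * M))) ≤ ε / 3 := by
    have e : K * (lam * (A / (lam ^ 2 * M))) = K * A / (lam * M) := by
      field_simp
    rw [e, div_le_iff₀ (by positivity)]
    have e2 : ε / 3 * (lam * M) = K * A + lam * ε / 3 := by
      rw [hM]; field_simp
    rw [e2]
    nlinarith [mul_pos hlam hε]
  calc |(∫ β in (2 * L - lam)..(2 * L + lam), montgomeryFormFactor β T) - 1|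
      ≤ K * (lam ^ 2 + lam * (A / (lam ^ 2 * M) + ((|(L : ℝ)| + 1) * (M / A) ^ 2 * R' T +
          1 / Real.log T)) + 1 / (lam * Real.sqrt (Real.log T))) := h
    _ = K * lam ^ 2 + K * (lam * (A / (lam ^ 2 * M))) +
          K * (lam * ((|(L : ℝ)| + 1) * (M / A) ^ 2 * R' T + 1 / Real.log T) +
            1 / (lam * Real.sqrt (Real.log T))) := by ring
    _ ≤ ε / 3 + ε / 3 + ε / 3 := add_le_add (add_le_add h1 h2) hsmall'.le
    _ = ε := by ring

/-- **(W-ii) The windows at non-integers, M-free limit form, uniformly on `|α| ≤ K`** (Lemma 6 (ii)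
under RH and AH-Pairs, all constants eliminated): for every `K` and `ε > 0` there is `λ₀ > 0` such
that for every `0 < λ ≤ λ₀`, for all large `T`, every `α` with `|α| ≤ K` at distance `≥ 2λ` from `ℤ`
has `|(1/2λ) ∫_{α−λ}^{α+λ} F(β, T) dβ − s(α)| ≤ ε`. Printed (ii):
"`(1/2λ) ∫_{α−λ}^{α+λ} F(β) dβ = s(α) + O(λ) + O(1/(λ⁵ √log T)) + O((1/λ) E_G(λ, L))`".
[cite: BaluyotGoldstonSuriajayaTurnageButterbaugh2025, Lemma 6 (ii) and §7] -/
theorem AH.window_nonint_limit (hRH : RiemannHypothesis) (hAH : AHPairs) (K : ℝ) {ε : ℝ}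
    (hε : 0 < ε) :
    ∃ lam0 : ℝ, 0 < lam0 ∧ ∀ lam : ℝ, 0 < lam → lam ≤ lam0 → ∀ᶠ T : ℝ in atTop, ∀ α : ℝ,
      |α| ≤ K → (∀ n : ℤ, 2 * lam ≤ |α - n|) →
        |1 / (2 * lam) * (∫ β in (α - lam)..(α + lam), montgomeryFormFactor β T) -
            triangleWave α| ≤ ε := by
  obtain ⟨A, hA, hU⟩ := AH.exists_uniform_input hRH
  obtain ⟨C₁, h₁⟩ := (bgstb2025_lemma5_rh_holds hRH).2
  obtain ⟨Kc, hKc⟩ : ∃ Kc : ℝ, Kc = 8 * (|C₁| + |(1 : ℝ)|) + 1 := ⟨_, rfl⟩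
  have hKc0 : 0 < Kc := by rw [hKc]; positivity
  refine ⟨min (1 / 4) (ε / (3 * Kc)), by positivity, ?_⟩
  intro lam hlam hlam0
  have hlam4 : lam ≤ 1 / 4 := hlam0.trans (min_le_left _ _)
  have hlamε : lam ≤ ε / (3 * Kc) := hlam0.trans (min_le_right _ _)
  obtain ⟨M, hM⟩ : ∃ M : ℝ, M = 3 * Kc * A / (lam ^ 3 * ε) + 1 := ⟨_, rfl⟩
  have hM0 : 0 < M := by rw [hM]; positivity
  obtain ⟨R', hR0, hRlim, h₂⟩ := hU M hM0 (hAH M hM0) (1 / 2) (by norm_num) (by norm_num)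
  have hM' : 0 < M / A := by positivity
  have hii := AH.lemma6_ii_core (C₂ := 1) hM' hR0 h₁
    (h₂.mono fun T hT lam hlam hlam2 α L ↦ (hT lam hlam hlam2 α).2 L)
  rw [← hKc] at hii
  have hcore := AH.lemma6_ii_uniform_core hM' hR0 hii
  -- the `T`-vanishing part (uniform in `|α| ≤ K`)
  have hg : Tendsto (fun T : ℝ ↦ Kc / (lam ^ 5 * Real.sqrt (Real.log T)) +
      Kc * (((|K| + 2) * (M / A) ^ 2 * R' T + 1 / Real.log T) / lam)) atTop (𝓝 0) := by
    have hs : Tendsto (fun T : ℝ ↦ Kc / (lam ^ 5 * Real.sqrt (Real.log T))) atTop (𝓝 0) := by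
      have h := u6_tendsto_const_div_sqrt_log (Kc / lam ^ 5)
      refine h.congr' (Eventually.of_forall fun T ↦ ?_)
      rw [div_div]
    have h := hs.add ((((hRlim.const_mul ((|K| + 2) * (M / A) ^ 2)).add
      u6_tendsto_one_div_log).div_const lam).const_mul Kc)
    simp only [mul_zero, zero_div, add_zero] at h
    exact h
  filter_upwards [hcore, hg.eventually (gt_mem_nhds (show (0 : ℝ) < ε / 3 by positivity)),
    eventually_gt_atTop (1 : ℝ)] with T hT hsmall hT1 α hαK hα
  have hsmall' : Kc / (lam ^ 5 * Real.sqrt (Real.log T)) +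
      Kc * (((|K| + 2) * (M / A) ^ 2 * R' T + 1 / Real.log T) / lam) < ε / 3 := hsmall
  have hlog : 0 < Real.log T := Real.log_pos hT1
  have h := hT lam hlam hlam4 α hα
  rw [abs_of_pos hKc0, AH.errG_level_div hA.ne' hM0.ne' hlam.ne',
    abs_of_nonneg (by positivity : (0 : ℝ) ≤ |α| + 1)] at h
  have hRT : 0 ≤ R' T := (hR0 T).le
  have h1 : Kc * lam ≤ ε / 3 := by
    calc Kc * lam ≤ Kc * (ε / (3 * Kc)) := by gcongr
      _ = ε / 3 := by field_simp
  have h2 : Kc * (A / (lam ^ 2 * M) / lam) ≤ ε / 3 := by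
    have e : Kc * (A / (lam ^ 2 * M) / lam) = Kc * A / (lam ^ 3 * M) := by
      field_simp
    rw [e, div_le_iff₀ (by positivity)]
    have e2 : ε / 3 * (lam ^ 3 * M) = Kc * A + lam ^ 3 * ε / 3 := by
      rw [hM]; field_simp
    rw [e2]
    nlinarith [mul_pos (pow_pos hlam 3) hε]
  have h3 : Kc * (((|α| + 1 + 1) * (M / A) ^ 2 * R' T + 1 / Real.log T) / lam) ≤
      Kc * (((|K| + 2) * (M / A) ^ 2 * R' T + 1 / Real.log T) / lam) := by
    have hαK' : |α| + 1 + 1 ≤ |K| + 2 := by linarith [le_abs_self K]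
    gcongr
  calc |1 / (2 * lam) * (∫ β in (α - lam)..(α + lam), montgomeryFormFactor β T) - triangleWave α|
      ≤ Kc * (lam + 1 / (lam ^ 5 * Real.sqrt (Real.log T)) +
          (A / (lam ^ 2 * M) + ((|α| + 1 + 1) * (M / A) ^ 2 * R' T + 1 / Real.log T)) / lam) := h
    _ = Kc * lam + Kc * (A / (lam ^ 2 * M) / lam) +
          (Kc / (lam ^ 5 * Real.sqrt (Real.log T)) +
            Kc * (((|α| + 1 + 1) * (M / A) ^ 2 * R' T + 1 / Real.log T) / lam)) := by
        field_simp
        ring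
    _ ≤ ε / 3 + ε / 3 + ε / 3 := by
        refine add_le_add (add_le_add h1 h2) ?_
        linarith [h3, hsmall']
    _ = ε := by ring

set_option maxHeartbeats 800000 in
/-- **(W-odd) The windows at the odd integers, M-free limit form** (Lemma 6 (iii) in OUR sound
two-sided form — lower half via Corollary 5 at `λ/2`, upper half via the tent majorant at a FIXED
`μ₀(ε)` — under RH and AH-Pairs, all constants eliminated; the bin parameter `M_b ≥ δ/2` of
`P₀ = AH.binDensity 0 T M_b δ` is arbitrary, the bin being independent of it): for every odd `K`,
`0 < δ ≤ 1/2`, `M_b ≥ δ/2` and `ε > 0` there is `λ₀ > 0` such that for every `0 < λ ≤ λ₀`,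
`|∫_{K−λ}^{K+λ} F(β, T) dβ − 2(P₀(T) − 1)| ≤ ε` for all large `T`. Printed (iii):
"`∫_{K−λ}^{K+λ} F(β) dβ = 2(P_0 − 1) + O(λ) + O(E_G(λ², K)) + O(1/(λ⁴ √log T))`" (whose printed
proof is unsupported, E-ah-5; this limit form is what §7 consumes).
[cite: BaluyotGoldstonSuriajayaTurnageButterbaugh2025, Lemma 6 (iii) and §7] -/
theorem AH.window_odd_limit (hRH : RiemannHypothesis) (hAH : AHPairs) (K : ℤ) (hK : Odd K) {δ : ℝ}
    (hδ : 0 < δ) (hδ2 : δ ≤ 1 / 2) {Mb : ℝ} (hMb : δ / 2 ≤ Mb) {ε : ℝ} (hε : 0 < ε) :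
    ∃ lam0 : ℝ, 0 < lam0 ∧ ∀ lam : ℝ, 0 < lam → lam ≤ lam0 → ∀ᶠ T : ℝ in atTop,
      |(∫ β in (K - lam)..(K + lam), montgomeryFormFactor β T) -
          2 * (AH.binDensity 0 T Mb δ - 1)| ≤ ε := by
  obtain ⟨A, hA, hU⟩ := AH.exists_uniform_input hRH
  obtain ⟨C₁, h₁⟩ := (bgstb2025_lemma5_rh_holds hRH).2
  obtain ⟨P, hP0, hP⟩ := AH.exists_binDensity_zero_le hRH hδ
  -- the absolute constants of the lower and upper bounds
  obtain ⟨c5, hc5⟩ : ∃ c5 : ℝ, c5 = 14 + 8 * |C₁| + 6 := ⟨_, rfl⟩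
  obtain ⟨Klo, hKlo⟩ : ∃ Klo : ℝ, Klo = 4 * |c5| + |(13 / 2 : ℝ)| := ⟨_, rfl⟩
  have hKlo0 : 0 < Klo := by rw [hKlo]; positivity
  obtain ⟨Kup, hKup⟩ : ∃ Kup : ℝ, Kup = |c5| + |(13 / 2 : ℝ)| := ⟨_, rfl⟩
  have hKup0 : 0 < Kup := by rw [hKup]; positivity
  -- the fixed outer radius `μ₀` and `λ₀`
  obtain ⟨mu, hmu⟩ : ∃ mu : ℝ, mu = min (1 / 4) (ε / (8 * Kup)) := ⟨_, rfl⟩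
  have hmu0 : 0 < mu := by rw [hmu]; positivity
  have hmu4 : mu ≤ 1 / 4 := by rw [hmu]; exact min_le_left _ _
  have hmuε : 2 * Kup * mu ≤ ε / 4 := by
    have : mu ≤ ε / (8 * Kup) := by rw [hmu]; exact min_le_right _ _
    rw [le_div_iff₀ (by positivity)] at this
    linarith
  refine ⟨min mu (min (ε / (4 * Klo)) (mu * ε / (8 * (P + 1)))), by positivity, ?_⟩
  intro lam hlam hlam0
  have hlm : lam ≤ mu := hlam0.trans (min_le_left _ _)
  have hlamε : lam ≤ ε / (4 * Klo) := (hlam0.trans (min_le_right _ _)).trans (min_le_left _ _)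
  have hlamP : lam ≤ mu * ε / (8 * (P + 1)) :=
    (hlam0.trans (min_le_right _ _)).trans (min_le_right _ _)
  have hlam2 : lam ≤ 1 / 2 := by linarith
  -- the AH level
  obtain ⟨M, hM⟩ : ∃ M : ℝ,
      M = Mb + 1 + 12 * Klo * A / (lam ^ 2 * ε) + 8 * Kup * A / (mu ^ 2 * ε) := ⟨_, rfl⟩
  have hMMb : Mb + 1 ≤ M := by
    rw [hM]
    have : 0 ≤ 12 * Klo * A / (lam ^ 2 * ε) := by positivity
    have : 0 ≤ 8 * Kup * A / (mu ^ 2 * ε) := by positivity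
    linarith
  have hM0 : 0 < M := by linarith
  have hMlo : 12 * Klo * A / (lam ^ 2 * ε) ≤ M := by
    rw [hM]
    have : 0 ≤ 8 * Kup * A / (mu ^ 2 * ε) := by positivity
    linarith
  have hMup : 8 * Kup * A / (mu ^ 2 * ε) ≤ M := by
    rw [hM]
    have : 0 ≤ 12 * Klo * A / (lam ^ 2 * ε) := by positivity
    linarith
  obtain ⟨R', hR0, hRlim, h₂⟩ := hU M hM0 (hAH M hM0) δ hδ hδ2
  have hM' : 0 < M / A := by positivity
  -- the cores at this level
  have h5 := AH.corollary5_core (C₂ := 1) hM' hR0 (by linarith : δ ≤ 1) h₁ h₂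
  have htr := AH.heathBrownG_odd_transport_core (C₂ := 1) hM' hR0
    (h₂.mono fun T hT lam hlam hlam2 α L ↦ (hT lam hlam hlam2 α).2 L)
  simp only [abs_one, mul_one] at h5 htr
  rw [← hc5] at h5
  have hlo := AH.lemma6_iii_lower_odd_core hM' hR0 h5 htr
  have hup := AH.lemma6_iii_upper_odd_core hRH hM' hR0 h5 htr
  rw [← hKlo] at hlo
  rw [← hKup] at hup
  -- bin independence
  have hbin : ∀ T, AH.binDensity 0 T M δ = AH.binDensity 0 T Mb δ := fun T ↦
    AH.binDensity_eq_binDensity_of_le (k := 0) (by simp; linarith) (by simp; linarith)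
  -- the `T`-vanishing parts
  have hglo : Tendsto (fun T : ℝ ↦ Klo * ((|(K : ℝ)| + 1) * (M / A) ^ 2 * R' T + 1 / Real.log T +
      4 / (lam ^ 2 * Real.sqrt (Real.log T)))) atTop (𝓝 0) := by
    have hs : Tendsto (fun T : ℝ ↦ 4 / (lam ^ 2 * Real.sqrt (Real.log T))) atTop (𝓝 0) := by
      have h := u6_tendsto_const_div_sqrt_log (4 / lam ^ 2)
      refine h.congr' (Eventually.of_forall fun T ↦ ?_)
      rw [div_div]
    have h := (((hRlim.const_mul ((|(K : ℝ)| + 1) * (M / A) ^ 2)).add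
      u6_tendsto_one_div_log).add hs).const_mul Klo
    simp only [mul_zero, add_zero] at h
    exact h
  have hgup : Tendsto (fun T : ℝ ↦ 2 * Kup * ((|(K : ℝ)| + 1) * (M / A) ^ 2 * R' T + 1 / Real.log T +
      1 / (mu ^ 2 * Real.sqrt (Real.log T)))) atTop (𝓝 0) := by
    have hs : Tendsto (fun T : ℝ ↦ 1 / (mu ^ 2 * Real.sqrt (Real.log T))) atTop (𝓝 0) := by
      have h := u6_tendsto_const_div_sqrt_log (1 / mu ^ 2)
      refine h.congr' (Eventually.of_forall fun T ↦ ?_)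
      rw [div_div]
    have h := (((hRlim.const_mul ((|(K : ℝ)| + 1) * (M / A) ^ 2)).add
      u6_tendsto_one_div_log).add hs).const_mul (2 * Kup)
    simp only [mul_zero, add_zero] at h
    exact h
  filter_upwards [hlo, hup, hP, hglo.eventually (gt_mem_nhds (show (0 : ℝ) < ε / 4 by positivity)),
    hgup.eventually (gt_mem_nhds (show (0 : ℝ) < ε / 4 by positivity)),
    eventually_gt_atTop (1 : ℝ)] with T hTlo hTup hPT hsmlo hsmup hT1
  have hsmlo' : Klo * ((|(K : ℝ)| + 1) * (M / A) ^ 2 * R' T + 1 / Real.log T +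
      4 / (lam ^ 2 * Real.sqrt (Real.log T))) < ε / 4 := hsmlo
  have hsmup' : 2 * Kup * ((|(K : ℝ)| + 1) * (M / A) ^ 2 * R' T + 1 / Real.log T +
      1 / (mu ^ 2 * Real.sqrt (Real.log T))) < ε / 4 := hsmup
  have hlog : 0 < Real.log T := Real.log_pos hT1
  have hsq : 0 < Real.sqrt (Real.log T) := Real.sqrt_pos.mpr hlog
  have hRT : 0 ≤ R' T := (hR0 T).le
  obtain ⟨-, hPT'⟩ := hPT M
  rw [← hbin T]
  set p : ℝ := AH.binDensity 0 T M δ with hp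
  -- LOWER
  have hL := hTlo lam hlam hlam2 K hK
  rw [AH.errG_level_div hA.ne' hM0.ne' (by positivity : lam / 2 ≠ 0)] at hL
  have eL : A / ((lam / 2) ^ 2 * M) = 4 * (A / (lam ^ 2 * M)) := by
    field_simp
    ring
  rw [eL] at hL
  have l1 : Klo * lam ≤ ε / 4 := by
    calc Klo * lam ≤ Klo * (ε / (4 * Klo)) := by gcongr
      _ = ε / 4 := by field_simp
  have l2 : Klo * (4 * (A / (lam ^ 2 * M))) ≤ ε / 3 := by
    have e : Klo * (4 * (A / (lam ^ 2 * M))) = 4 * Klo * A / (lam ^ 2 * M) := by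
      field_simp
    rw [e, div_le_iff₀ (by positivity)]
    have := (div_le_iff₀ (by positivity : (0 : ℝ) < lam ^ 2 * ε)).mp hMlo
    linarith
  have hlower : 2 * (p - 1) - ε ≤ ∫ β in (K - lam)..(K + lam), montgomeryFormFactor β T := by
    have e : Klo * (lam + (4 * (A / (lam ^ 2 * M)) + ((|(K : ℝ)| + 1) * (M / A) ^ 2 * R' T +
        1 / Real.log T)) + 1 / (lam ^ 2 * Real.sqrt (Real.log T))) =
        Klo * lam + Klo * (4 * (A / (lam ^ 2 * M))) +
          Klo * ((|(K : ℝ)| + 1) * (M / A) ^ 2 * R' T + 1 / Real.log T +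
            4 / (lam ^ 2 * Real.sqrt (Real.log T))) -
          Klo * (3 / (lam ^ 2 * Real.sqrt (Real.log T))) := by ring
    have hpos : 0 ≤ Klo * (3 / (lam ^ 2 * Real.sqrt (Real.log T))) := by positivity
    linarith [hL, e, l1, l2, hsmlo'.le, hpos]
  -- UPPER (at the fixed outer radius `μ₀`)
  have hUp := hTup lam mu hlam hlm hmu4 K hK
  rw [AH.errG_level_div hA.ne' hM0.ne' hmu0.ne'] at hUp
  have ht0 : 0 ≤ lam ^ 2 / mu ^ 2 := by positivity
  have hlm' : lam / mu ≤ 1 := by rw [div_le_one hmu0]; exact hlm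
  have ht1 : lam ^ 2 / mu ^ 2 ≤ lam / mu := by
    rw [show lam ^ 2 / mu ^ 2 = (lam / mu) * (lam / mu) by ring]
    calc lam / mu * (lam / mu) ≤ lam / mu * 1 := by gcongr
      _ = lam / mu := mul_one _
  have htP : lam ^ 2 / mu ^ 2 * (2 * (P + 1)) ≤ ε / 4 := by
    calc lam ^ 2 / mu ^ 2 * (2 * (P + 1)) ≤ lam / mu * (2 * (P + 1)) := by gcongr
      _ ≤ ε / 4 := by
          rw [div_mul_eq_mul_div, div_le_iff₀ hmu0]
          rw [le_div_iff₀ (by positivity)] at hlamP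
          linarith
  have u2 : 2 * Kup * (A / (mu ^ 2 * M)) ≤ ε / 4 := by
    have e : 2 * Kup * (A / (mu ^ 2 * M)) = 2 * Kup * A / (mu ^ 2 * M) := by
      field_simp
    rw [e, div_le_iff₀ (by positivity)]
    have := (div_le_iff₀ (by positivity : (0 : ℝ) < mu ^ 2 * ε)).mp hMup
    linarith
  have hupper : (∫ β in (K - lam)..(K + lam), montgomeryFormFactor β T) ≤ 2 * (p - 1) + ε := by
    refine u6_up_bookkeeping ht0 (ht1.trans hlm') hPT' htP hKup0.le hmu0.le hmuε
      (by positivity) u2 (by positivity) hsmup' ?_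
    have e : mu + (A / (mu ^ 2 * M) + ((|(K : ℝ)| + 1) * (M / A) ^ 2 * R' T + 1 / Real.log T)) +
        1 / (mu ^ 2 * Real.sqrt (Real.log T)) =
        mu + A / (mu ^ 2 * M) + ((|(K : ℝ)| + 1) * (M / A) ^ 2 * R' T + 1 / Real.log T +
          1 / (mu ^ 2 * Real.sqrt (Real.log T))) := by ring
    rw [e] at hUp
    exact hUp
  rw [abs_le]
  constructor <;> linarith

set_option maxHeartbeats 800000 in
/-- **(W-one) The one-sided window at `1`, M-free limit form** (OUR sound replacement of the
printed p. 15 conclusion "`∫_1^{1+λ} F(w) dw = 2(P_0 − 1) + O(λ) + …`", E-ah-5: lower half via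
Corollary 5 at `λ/2` and Lemma 6 (iv), upper half via the tent majorant; under RH and AH-Pairs, all
constants eliminated): for `0 < δ ≤ 1/2`, `M_b ≥ δ/2` and `ε > 0` there is `λ₀ > 0` such that for
every `0 < λ ≤ λ₀`, `|∫_1^{1+λ} F(β, T) dβ − 2(P₀(T) − 1)| ≤ ε` for all large `T` (the window
left of `−1` follows by `integral_formFactor_left_of_neg_one_eq`).
[cite: BaluyotGoldstonSuriajayaTurnageButterbaugh2025, §6, proof of Lemma 6 (iii)–(v), and §7] -/
theorem AH.window_one_limit (hRH : RiemannHypothesis) (hAH : AHPairs) {δ : ℝ} (hδ : 0 < δ)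
    (hδ2 : δ ≤ 1 / 2) {Mb : ℝ} (hMb : δ / 2 ≤ Mb) {ε : ℝ} (hε : 0 < ε) :
    ∃ lam0 : ℝ, 0 < lam0 ∧ ∀ lam : ℝ, 0 < lam → lam ≤ lam0 → ∀ᶠ T : ℝ in atTop,
      |(∫ β in (1 : ℝ)..(1 + lam), montgomeryFormFactor β T) -
          2 * (AH.binDensity 0 T Mb δ - 1)| ≤ ε := by
  obtain ⟨A, hA, hU⟩ := AH.exists_uniform_input hRH
  obtain ⟨C₁, h₁⟩ := (bgstb2025_lemma5_rh_holds hRH).2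
  obtain ⟨C₄, hC₄⟩ := bgstb2025_lemma6_iv hRH
  obtain ⟨P, hP0, hP⟩ := AH.exists_binDensity_zero_le hRH hδ
  obtain ⟨c5, hc5⟩ : ∃ c5 : ℝ, c5 = 14 + 8 * |C₁| + 6 := ⟨_, rfl⟩
  obtain ⟨clo, hclo⟩ : ∃ clo : ℝ, clo = 4 * |c5| + |(13 / 2 : ℝ)| := ⟨_, rfl⟩
  have hclo0 : 0 < clo := by rw [hclo]; positivity
  obtain ⟨Klo, hKlo⟩ : ∃ Klo : ℝ, Klo = |clo| + |C₄| := ⟨_, rfl⟩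
  have hKlo0 : 0 < Klo := by rw [hKlo]; positivity
  obtain ⟨Kup, hKup⟩ : ∃ Kup : ℝ, Kup = |c5| + |(13 / 2 : ℝ)| := ⟨_, rfl⟩
  have hKup0 : 0 < Kup := by rw [hKup]; positivity
  obtain ⟨mu, hmu⟩ : ∃ mu : ℝ, mu = min (1 / 4) (ε / (8 * Kup)) := ⟨_, rfl⟩
  have hmu0 : 0 < mu := by rw [hmu]; positivity
  have hmu4 : mu ≤ 1 / 4 := by rw [hmu]; exact min_le_left _ _
  have hmuε : 2 * Kup * mu ≤ ε / 4 := by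
    have : mu ≤ ε / (8 * Kup) := by rw [hmu]; exact min_le_right _ _
    rw [le_div_iff₀ (by positivity)] at this
    linarith
  refine ⟨min mu (min (ε / (4 * Klo)) (mu * ε / (8 * (P + 1)))), by positivity, ?_⟩
  intro lam hlam hlam0
  have hlm : lam ≤ mu := hlam0.trans (min_le_left _ _)
  have hlamε : lam ≤ ε / (4 * Klo) := (hlam0.trans (min_le_right _ _)).trans (min_le_left _ _)
  have hlamP : lam ≤ mu * ε / (8 * (P + 1)) :=
    (hlam0.trans (min_le_right _ _)).trans (min_le_right _ _)
  have hlam4 : lam ≤ 1 / 4 := hlm.trans hmu4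
  obtain ⟨M, hM⟩ : ∃ M : ℝ,
      M = Mb + 1 + 12 * Klo * A / (lam ^ 2 * ε) + 8 * Kup * A / (mu ^ 2 * ε) := ⟨_, rfl⟩
  have hMMb : Mb + 1 ≤ M := by
    rw [hM]
    have : 0 ≤ 12 * Klo * A / (lam ^ 2 * ε) := by positivity
    have : 0 ≤ 8 * Kup * A / (mu ^ 2 * ε) := by positivity
    linarith
  have hM0 : 0 < M := by linarith
  have hMlo : 12 * Klo * A / (lam ^ 2 * ε) ≤ M := by
    rw [hM]
    have : 0 ≤ 8 * Kup * A / (mu ^ 2 * ε) := by positivity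
    linarith
  have hMup : 8 * Kup * A / (mu ^ 2 * ε) ≤ M := by
    rw [hM]
    have : 0 ≤ 12 * Klo * A / (lam ^ 2 * ε) := by positivity
    linarith
  obtain ⟨R', hR0, hRlim, h₂⟩ := hU M hM0 (hAH M hM0) δ hδ hδ2
  have hM' : 0 < M / A := by positivity
  have h5 := AH.corollary5_core (C₂ := 1) hM' hR0 (by linarith : δ ≤ 1) h₁ h₂
  have htr := AH.heathBrownG_odd_transport_core (C₂ := 1) hM' hR0
    (h₂.mono fun T hT lam hlam hlam2 α L ↦ (hT lam hlam hlam2 α).2 L)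
  simp only [abs_one, mul_one] at h5 htr
  rw [← hc5] at h5
  have hlo' := AH.lemma6_iii_lower_odd_core hM' hR0 h5 htr
  rw [← hclo] at hlo'
  have hlo := AH.right_of_one_lower_core hM' hR0 hlo' hC₄
  have hup' := AH.lemma6_iii_upper_odd_core hRH hM' hR0 h5 htr
  have hup := AH.right_of_one_upper_core hup'
  rw [← hKlo] at hlo
  rw [← hKup] at hup
  have hbin : ∀ T, AH.binDensity 0 T M δ = AH.binDensity 0 T Mb δ := fun T ↦
    AH.binDensity_eq_binDensity_of_le (k := 0) (by simp; linarith) (by simp; linarith)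
  have hglo : Tendsto (fun T : ℝ ↦ Klo * (2 * (M / A) ^ 2 * R' T + 1 / Real.log T +
      4 / (lam ^ 2 * Real.sqrt (Real.log T)))) atTop (𝓝 0) := by
    have hs : Tendsto (fun T : ℝ ↦ 4 / (lam ^ 2 * Real.sqrt (Real.log T))) atTop (𝓝 0) := by
      have h := u6_tendsto_const_div_sqrt_log (4 / lam ^ 2)
      refine h.congr' (Eventually.of_forall fun T ↦ ?_)
      rw [div_div]
    have h := (((hRlim.const_mul (2 * (M / A) ^ 2)).add u6_tendsto_one_div_log).add hs).const_mul Klo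
    simp only [mul_zero, add_zero] at h
    exact h
  have hgup : Tendsto (fun T : ℝ ↦ 2 * Kup * (2 * (M / A) ^ 2 * R' T + 1 / Real.log T +
      1 / (mu ^ 2 * Real.sqrt (Real.log T)))) atTop (𝓝 0) := by
    have hs : Tendsto (fun T : ℝ ↦ 1 / (mu ^ 2 * Real.sqrt (Real.log T))) atTop (𝓝 0) := by
      have h := u6_tendsto_const_div_sqrt_log (1 / mu ^ 2)
      refine h.congr' (Eventually.of_forall fun T ↦ ?_)
      rw [div_div]
    have h := (((hRlim.const_mul (2 * (M / A) ^ 2)).add u6_tendsto_one_div_log).add hs).const_mul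
      (2 * Kup)
    simp only [mul_zero, add_zero] at h
    exact h
  filter_upwards [hlo, hup, hP, hglo.eventually (gt_mem_nhds (show (0 : ℝ) < ε / 4 by positivity)),
    hgup.eventually (gt_mem_nhds (show (0 : ℝ) < ε / 4 by positivity)),
    eventually_gt_atTop (1 : ℝ)] with T hTlo hTup hPT hsmlo hsmup hT1
  have hsmlo' : Klo * (2 * (M / A) ^ 2 * R' T + 1 / Real.log T +
      4 / (lam ^ 2 * Real.sqrt (Real.log T))) < ε / 4 := hsmlo
  have hsmup' : 2 * Kup * (2 * (M / A) ^ 2 * R' T + 1 / Real.log T +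
      1 / (mu ^ 2 * Real.sqrt (Real.log T))) < ε / 4 := hsmup
  have hlog : 0 < Real.log T := Real.log_pos hT1
  have hsq : 0 < Real.sqrt (Real.log T) := Real.sqrt_pos.mpr hlog
  have hRT : 0 ≤ R' T := (hR0 T).le
  obtain ⟨-, hPT'⟩ := hPT M
  rw [← hbin T]
  set p : ℝ := AH.binDensity 0 T M δ with hp
  -- LOWER
  have hL := hTlo lam hlam hlam4
  rw [AH.errG_level_div hA.ne' hM0.ne' (by positivity : lam / 2 ≠ 0), abs_one] at hL
  have eL : A / ((lam / 2) ^ 2 * M) = 4 * (A / (lam ^ 2 * M)) := by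
    field_simp
    ring
  rw [eL] at hL
  have l1 : Klo * lam ≤ ε / 4 := by
    calc Klo * lam ≤ Klo * (ε / (4 * Klo)) := by gcongr
      _ = ε / 4 := by field_simp
  have l2 : Klo * (4 * (A / (lam ^ 2 * M))) ≤ ε / 3 := by
    have e : Klo * (4 * (A / (lam ^ 2 * M))) = 4 * Klo * A / (lam ^ 2 * M) := by
      field_simp
    rw [e, div_le_iff₀ (by positivity)]
    have := (div_le_iff₀ (by positivity : (0 : ℝ) < lam ^ 2 * ε)).mp hMlo
    linarith
  have hlower : 2 * (p - 1) - ε ≤ ∫ β in (1 : ℝ)..(1 + lam), montgomeryFormFactor β T := by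
    have e : Klo * (lam + (4 * (A / (lam ^ 2 * M)) + ((1 + 1) * (M / A) ^ 2 * R' T +
        1 / Real.log T)) + 1 / (lam ^ 2 * Real.sqrt (Real.log T))) =
        Klo * lam + Klo * (4 * (A / (lam ^ 2 * M))) +
          Klo * (2 * (M / A) ^ 2 * R' T + 1 / Real.log T +
            4 / (lam ^ 2 * Real.sqrt (Real.log T))) -
          Klo * (3 / (lam ^ 2 * Real.sqrt (Real.log T))) := by ring
    have hpos : 0 ≤ Klo * (3 / (lam ^ 2 * Real.sqrt (Real.log T))) := by positivity
    linarith [hL, e, l1, l2, hsmlo'.le, hpos]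
  -- UPPER
  have hUp := hTup lam mu hlam hlm hmu4
  rw [AH.errG_level_div hA.ne' hM0.ne' hmu0.ne', abs_one] at hUp
  have ht0 : 0 ≤ lam ^ 2 / mu ^ 2 := by positivity
  have hlm' : lam / mu ≤ 1 := by rw [div_le_one hmu0]; exact hlm
  have ht1 : lam ^ 2 / mu ^ 2 ≤ lam / mu := by
    rw [show lam ^ 2 / mu ^ 2 = (lam / mu) * (lam / mu) by ring]
    calc lam / mu * (lam / mu) ≤ lam / mu * 1 := by gcongr
      _ = lam / mu := mul_one _
  have htP : lam ^ 2 / mu ^ 2 * (2 * (P + 1)) ≤ ε / 4 := by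
    calc lam ^ 2 / mu ^ 2 * (2 * (P + 1)) ≤ lam / mu * (2 * (P + 1)) := by gcongr
      _ ≤ ε / 4 := by
          rw [div_mul_eq_mul_div, div_le_iff₀ hmu0]
          rw [le_div_iff₀ (by positivity)] at hlamP
          linarith
  have u2 : 2 * Kup * (A / (mu ^ 2 * M)) ≤ ε / 4 := by
    have e : 2 * Kup * (A / (mu ^ 2 * M)) = 2 * Kup * A / (mu ^ 2 * M) := by
      field_simp
    rw [e, div_le_iff₀ (by positivity)]
    have := (div_le_iff₀ (by positivity : (0 : ℝ) < mu ^ 2 * ε)).mp hMup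
    linarith
  have hupper : (∫ β in (1 : ℝ)..(1 + lam), montgomeryFormFactor β T) ≤ 2 * (p - 1) + ε := by
    refine u6_up_bookkeeping ht0 (ht1.trans hlm') hPT' htP hKup0.le hmu0.le hmuε
      (by positivity) u2 (by positivity) hsmup' ?_
    have e : mu + (A / (mu ^ 2 * M) + ((1 + 1) * (M / A) ^ 2 * R' T + 1 / Real.log T)) +
        1 / (mu ^ 2 * Real.sqrt (Real.log T)) =
        mu + A / (mu ^ 2 * M) + (2 * (M / A) ^ 2 * R' T + 1 / Real.log T +
          1 / (mu ^ 2 * Real.sqrt (Real.log T))) := by ring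
    rw [e] at hUp
    exact hUp
  rw [abs_le]
  constructor <;> linarith

end Literature.NumberTheory.LFunctions

end
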